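import Literature.Computability.Cryptography.HILLGenerator
import Literature.Computability.Cryptography.PseudorandomGeneratorsStretchOne
import Literature.Computability.Cryptography.OneWayFunctionsLengthPreserving
import HarnessLib

/-!
# A pseudorandom generator from any one-way function (Håstad–Impagliazzo–Levin–Luby 1999)

> **Theorem 6.2.2** There are one-way functions iff there are pseudorandom generators.
> *Proof*: That pseudorandom generators imply one-way functions follows from [Levin 87]. The converse now
> follows from Theorem 6.2.1 and the results summarized in Subsection 4.9. [HILL 1999, §6.2, p. 30]
>
> **§7, A direct construction.** … only one product distribution is needed for the overall proof. …
> **Construction 7.0.4** `g(X', Y', R₁, R₂, R₃) = ⟨h_{R₁}(X'), h_{R₂}(b^{kₙ}(X', Y')), h_{R₃}(f'^{kₙ}(X')), Y', R₁, R₂, R₃⟩`.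
> **Theorem 7.0.5** If `f` is a one-way function and `g` is as in Construction 7.0.4, then `g` is a mildly
> non-uniform pseudorandom generator. … We still need to use Proposition 4.8.1 to get rid of the mild
> non-uniformity: an approximation of both `eₙ` and `pₙ` that is within `1/(8n)` of their true values is
> sufficient. [HILL 1999, §7, pp. 37–39]

This file completes the tree's formalization of the `←` direction of `PRGExist_iff_OWFExist`
(`Pseudorandomness.lean`, crypto-foundations.S07) along HILL's *direct construction* of §7, for UNIFORM
adversaries (the tree's `IsPRG` / `IsOneWay`, Goldreich 2001 Defs. 3.3.1 / 2.2.1), and discharges the named fact: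
**`PRGExist_iff_OWFExist_holds`** (last declaration). The `→` direction is the tree's `OWFExist_of_PRGExist`
(`PseudorandomGeneratorsStretchOne.lean`, Goldreich 2001 Prop. 3.3.8); w.l.o.g. the one-way function is
length-preserving (`OWFExist.exists_isLengthPreserving`, `OneWayFunctionsLengthPreserving.lean`, Goldreich 2001
Prop. 2.2.5). Earlier files of the series supply: the false-entropy function `f'(x, i, r) = ⟨f x, h_r(x)↾i, i, r⟩`
and its hiding over `𝒯` (`HILLHashedFunction`, `HILLAtoms`: Lemma 6.1.1), the greedy two-phase oracle machine of
Lemma 6.3.2, its laws and the assembled Cor. 6.3.3 `𝒟 ≈_c ℰ` (`HILLGreedySelection`, `HILLGreedySamplers`,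
`HILLGreedyMachine`, `HILLGreedyLaws`, `HILLGreedyLeftover`, `HILLGreedyHybrid`: `isCompIndistinguishable_DE`),
the conditional-entropy bound behind Lemma 6.3.1 / Cor. 4.5.3 (`HILLEntropy`, `HILLExtract`, `HILLExtractSmooth`:
flattening + leftover hashing), closure of computational indistinguishability under advice-taking `FP`
post-processing and under appending fresh coins (`IndistinguishabilityAdvicePostProcessing`,
`IndistinguishabilityAdviceAppend`), Proposition 4.8.1 with Prop. 3.3.4 (`MildlyNonuniformPRG`:
`PRGExist_of_advice_levels`, the XOR of all advice candidates), and the mathematical layer of Construction 7.0.4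
with the hybrid chain `X0 ≈ₛ X1 ≈_c X2 ≈ₛ X3` of the proof of Thm 7.0.5 (`HILLGenerator`: `coreOut`, `phiStr`,
`isCompIndistinguishable_X1_X2`, `abs_prX0_sub_prX1_le`, `abs_prX2_sub_prX3_le`).

Contents (two parts, each opened by its own `/-! ## Part … -/` docstring):
* **Part I** (§7, programs) — the simulator `Φ` and the generator core as `FP` string programs
  (`Params.GenProg.phiF_mem_FP`, `genF_mem_FP`) with their value lemmas.
* **Part II** (§7 with §6.2 eq. (4)–(7), §4.8) — the concrete parameters (`kc(N) = 120N³ + 16N + 16`, the hash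
  output lengths `m₁, m₂, m₃`, the advice `a*(N)` encoding `(t*, e*)`), the exponent arithmetic
  (`surplus ≥ 1`: the generator stretches), padding/truncation to the polynomial seed length, Thm 7.0.5 for the
  correct advice (`isPseudorandom_G₀`), Prop. 4.8.1 (`PRGExist_of_isOneWay_lengthPreserving`), and finally
  `PRGExist_of_OWFExist` and `PRGExist_iff_OWFExist_holds`.

Model note (as everywhere in this directory): probabilistic polynomial time is the tree's `RandAlg.IsPPT`, whose
coin budget is an arbitrary polynomially bounded function of the input length, so "uniform" adversaries carry
`O(log n)` bits of advice through their coin count; both sides of the equivalence quantify over the same class.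
Deviations from print (all conservative): `K = ⌊log₂ N⌋` Goldreich–Levin bits per copy instead of one inner-product
bit (Prop. 4.1.2 in the Liu–Pass hiding form already in the tree), the affine hash family for all three hashes,
and explicit polynomial parameters in place of `kₙ = 2000n⁶`, `2nkₙ^{2/3}`. No new named facts (net debt −1).
-/

/-!
## Part I — HILL's Construction 7.0.4 as `FP` programs

The simulator `Φ` of the computational step and the generator core `g_{ẽ,p̃}` of `HILLGenerator.lean` as
polynomial-time string functions reading `⟨1^N, ⟨1^a, β⟩⟩` (level, advice, data): the lengths
`K, 2^b, k, cP, Lg, EB, t, e, mlen, uLen, sLen, slack, m₃, M13, m₁, |U₁|, |U₃|` in unary by the brick algebra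
(`logFn`, `polyFn`, `umulFn`, `divModFn`, `binToUnaryFn`, `dropFn`), the slices by `takeFn`/`dropFn`, `F'(pubs)`,
`Y'(pubs)` by counted folds (`foldLoop`, as `HILLGreedySamplers.pubsF`), `h₃` by `AffineProg.hashFn`; the generator
reuses `Φ` after sampling `𝒟` with `HILLGreedySamplers.DsampleF` and hashing `h₁`. Values: `phiF_apply`,
`genF_apply`; membership: `phiF_mem_FP`, `genF_mem_FP`. [HILL 1999, Construction 7.0.4; Arora–Barak 2009, §1.3]
No new named facts.
-/

namespace Literature.Computability.Cryptography

open Finset _root_.Computability Complexity Complexity.Brick Complexity.Plumb Complexity.OracleCompose Polynomial AffineStr HCProd PRGTrunc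

namespace HILL

namespace GH

namespace Params

namespace GenProg

variable {P : Params} (f : List Bool → List Bool) (kcP : Polynomial ℕ) (mlenF : List Bool → List Bool)

/-! ### Accessors of `w = ⟨1^N, ⟨1^a, β⟩⟩` and unary lengths -/

/-- `1^N`. [folklore] -/
noncomputable def NW : List Bool → List Bool := fstF
/-- `1^a`. [folklore] -/
noncomputable def aW : List Bool → List Bool := fstF ∘ sndF
/-- `β`. [folklore] -/
noncomputable def bW : List Bool → List Bool := sndF ∘ sndF
/-- `1^K`, `K = ⌊log₂ N⌋`. [folklore] -/
noncomputable def KW : List Bool → List Bool := logFn ∘ NW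
/-- `1^{2N+2}`. [folklore] -/
noncomputable def twoN2W : List Bool → List Bool := polyFn (2 * X + 2) ∘ NW
/-- `1^{2^{b(N)}}` (`b = K + 1`; `2^b − 1 = ⟦1^{K+1}⟧` by `binToUnaryFn`, then one more). [folklore] -/
noncomputable def pow2bW : List Bool → List Bool := List.cons true ∘ binToUnaryFn ∘ fanoutFn twoN2W (List.cons true ∘ KW)
/-- `1^k`, `k = kcP³`. [folklore] -/
noncomputable def kkW : List Bool → List Bool := polyFn (kcP ^ 3) ∘ NW
/-- `1^{rlen N}`. [folklore] -/
noncomputable def rlW : List Bool → List Bool := polyFn R0 ∘ NW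
/-- `1^{K·N}`. [folklore] -/
noncomputable def KNW : List Bool → List Bool := HashBricks.umulFn ∘ fanoutFn KW NW
/-- `1^{N + rlen + K}`. [folklore] -/
noncomputable def cW : List Bool → List Bool := concatFn ∘ fanoutFn (concatFn ∘ fanoutFn NW rlW) KW
/-- `1^{cP N}`. [folklore] -/
noncomputable def cPW : List Bool → List Bool := concatFn ∘ fanoutFn (concatFn ∘ fanoutFn (concatFn ∘ fanoutFn NW rlW) KNW) KW
/-- `1^{k·cP}`. [folklore] -/
noncomputable def LpW : List Bool → List Bool := HashBricks.umulFn ∘ fanoutFn (kkW kcP) cPW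
/-- `1^{Lg N}`. [folklore] -/
noncomputable def LgW : List Bool → List Bool := LgU f ∘ fanoutFn NW NW
/-- `1^{k·Lg}`. [folklore] -/
noncomputable def fLenW : List Bool → List Bool := HashBricks.umulFn ∘ fanoutFn (kkW kcP) (LgW f)
/-- `1^{pubLen N}`. [folklore] -/
noncomputable def pubLenW : List Bool → List Bool := concatFn ∘ fanoutFn (LgW f) KNW
/-- `1^{EB N}`. [folklore] -/
noncomputable def EBW : List Bool → List Bool :=
  HashBricks.umulFn ∘ fanoutFn (HashBricks.umulFn ∘ fanoutFn (fun _ => ones 8) (List.cons true ∘ LgW f)) pow2bW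
/-- `⟨1^t, 1^e⟩ = divMod(a, EB)`. [folklore] -/
noncomputable def teW : List Bool → List Bool := divModFn ∘ fanoutFn (EBW f) aW
/-- `1^t`. [folklore] -/
noncomputable def tW : List Bool → List Bool := fstF ∘ teW f
/-- `1^e`. [folklore] -/
noncomputable def eW : List Bool → List Bool := sndF ∘ teW f
/-- `1^{mlen N t}`. [folklore] -/
noncomputable def mlW : List Bool → List Bool := mlenF ∘ fanoutFn NW (tW f)
/-- `1^{k·K}`. [folklore] -/
noncomputable def kKW : List Bool → List Bool := HashBricks.umulFn ∘ fanoutFn (kkW kcP) KW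
/-- `1^{uLen N t}`. [folklore] -/
noncomputable def uLW : List Bool → List Bool := HashBricks.umulFn ∘ fanoutFn (List.cons true ∘ kKW kcP) (mlW f mlenF)
/-- `1^{k·pubLen}`. [folklore] -/
noncomputable def kpW : List Bool → List Bool := HashBricks.umulFn ∘ fanoutFn (kkW kcP) (pubLenW f)
/-- `1^{sLen N t}`. [folklore] -/
noncomputable def sLW : List Bool → List Bool := concatFn ∘ fanoutFn (concatFn ∘ fanoutFn (mlW f mlenF) (kpW f kcP)) (uLW f kcP mlenF)
/-- `1^{slack} = 1^{k/(16·2^b)}`. [folklore] -/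
noncomputable def slackW : List Bool → List Bool := fstF ∘ divModFn ∘ fanoutFn (HashBricks.umulFn ∘ fanoutFn (fun _ => ones 16) pow2bW) (kkW kcP)
/-- `1^{m₃}`. [folklore] -/
noncomputable def m3W : List Bool → List Bool :=
  dropFn ∘ fanoutFn twoN2W (dropFn ∘ fanoutFn (slackW kcP)
    (fstF ∘ divModFn ∘ fanoutFn (HashBricks.umulFn ∘ fanoutFn (fun _ => ones 4) pow2bW)
      (HashBricks.umulFn ∘ fanoutFn (HashBricks.umulFn ∘ fanoutFn (kkW kcP) (eW f)) KW)))
/-- `1^{M13}`. [folklore] -/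
noncomputable def M13W : List Bool → List Bool :=
  dropFn ∘ fanoutFn (fun _ => ones 3) (dropFn ∘ fanoutFn (HashBricks.umulFn ∘ fanoutFn (fun _ => ones 2) twoN2W)
    (dropFn ∘ fanoutFn (HashBricks.umulFn ∘ fanoutFn (fun _ => ones 2) (slackW kcP))
      (dropFn ∘ fanoutFn (fstF ∘ divModFn ∘ fanoutFn pow2bW (HashBricks.umulFn ∘ fanoutFn (kKW kcP) (tW f)))
        (concatFn ∘ fanoutFn (HashBricks.umulFn ∘ fanoutFn (kkW kcP) cW)
          (fstF ∘ divModFn ∘ fanoutFn (HashBricks.umulFn ∘ fanoutFn (fun _ => ones 2) pow2bW) (kKW kcP))))))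
/-- `1^{m₁}`. [folklore] -/
noncomputable def m1W : List Bool → List Bool := dropFn ∘ fanoutFn (m3W f kcP) (M13W f kcP)
/-- `1^{|U₁|}`. [folklore] -/
noncomputable def key1W : List Bool → List Bool := HashBricks.umulFn ∘ fanoutFn (m1W f kcP) (List.cons true ∘ LpW kcP)
/-- `1^{|U₃|}`. [folklore] -/
noncomputable def key3W : List Bool → List Bool := HashBricks.umulFn ∘ fanoutFn (m3W f kcP) (List.cons true ∘ fLenW f kcP)

variable {f kcP mlenF}

/-- `|1ⁿ| = n`. [folklore] -/
private theorem length_unary (n : ℕ) : (unaryEncodeNat n).length = n := unary_decode_encode_nat n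

/-- `1ⁿ = ones n`. [folklore] -/
private theorem unary_eq_ones (n : ℕ) : unaryEncodeNat n = ones n := by simp [ones, Complexity.unaryEncodeNat_eq_replicate]

/-- The genuine input `⟨1^N, ⟨1^a, β⟩⟩`. [folklore] -/
def winp (N a : ℕ) (β : List Bool) : List Bool := boolPair (unaryEncodeNat N) (boolPair (ones a) β)

section Values

variable (hS : ProgSpec P kcP mlenF) (hlp : IsLengthPreserving f) (N a : ℕ) (β : List Bool)
include hS

omit hS in
/-- Value of the unary helper on a genuine input. [folklore] -/
theorem NW_apply : NW (winp N a β) = ones N := by simp [NW, winp, unary_eq_ones]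
omit hS in
/-- Value of the unary helper on a genuine input. [folklore] -/
theorem aW_apply : aW (winp N a β) = ones a := by simp [aW, winp]
omit hS in
/-- Value of the unary helper on a genuine input. [folklore] -/
theorem bW_apply : bW (winp N a β) = β := by simp [bW, winp]
omit hS in
/-- Value of the unary helper on a genuine input. [folklore] -/
theorem KW_apply : KW (winp N a β) = ones (kL N) := by
  rw [KW, Function.comp_apply, NW_apply, logFn]; simp [ones, kL]
omit hS in
/-- Value of the unary helper on a genuine input. [folklore] -/
theorem twoN2W_apply : twoN2W (winp N a β) = ones (2 * N + 2) := by
  rw [twoN2W, Function.comp_apply, NW_apply, polyFn_apply]; simp [ones]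
omit hS in
/-- Value of the unary helper on a genuine input. [folklore] -/
theorem pow2bW_apply : pow2bW (winp N a β) = ones (2 ^ bLen N) := by
  rw [pow2bW, Function.comp_apply, Function.comp_apply, fanoutFn_apply, twoN2W_apply, Function.comp_apply, KW_apply,
    show true :: ones (kL N) = ones (kL N + 1) by simp [ones, List.replicate_succ], binToUnaryFn_boolPair, bitsToNat_ones]
  have h1 : 2 ^ (kL N + 1) - 1 ≤ (ones (2 * N + 2)).length := by
    simp only [ones, List.length_replicate]; have := two_pow_bLen_le N; rw [bLen] at this; rw [kL]; omega
  rw [Nat.min_eq_left h1, bLen, kL]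
  have : 1 ≤ 2 ^ (Nat.log 2 N + 1) := Nat.one_le_two_pow
  simp only [ones]
  rw [← List.replicate_succ, Nat.sub_add_cancel this]
/-- Value of the unary helper on a genuine input. [folklore] -/
theorem kkW_apply : kkW kcP (winp N a β) = ones (P.kk N) := by
  rw [kkW, Function.comp_apply, NW_apply, polyFn_apply]; simp [ones, hS.kk_eq]
omit hS in
/-- Value of the unary helper on a genuine input. [folklore] -/
theorem rlW_apply : rlW (winp N a β) = ones (rlen N) := by
  rw [rlW, Function.comp_apply, NW_apply, polyFn_apply]; simp [ones, R0_eval]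
omit hS in
/-- Value of the unary helper on a genuine input. [folklore] -/
theorem KNW_apply : KNW (winp N a β) = ones (kL N * N) := by
  rw [KNW, Function.comp_apply, fanoutFn_apply, KW_apply, NW_apply, HashBricks.umulFn_boolPair]
omit hS in
/-- Value of the unary helper on a genuine input. [folklore] -/
theorem cW_apply : cW (winp N a β) = ones (N + rlen N + kL N) := by
  rw [cW, Function.comp_apply, fanoutFn_apply, Function.comp_apply, fanoutFn_apply, NW_apply, rlW_apply, KW_apply, concatFn_boolPair,
    concatFn_boolPair, Com.ones_append, Com.ones_append]
omit hS in
/-- Value of the unary helper on a genuine input. [folklore] -/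
theorem cPW_apply : cPW (winp N a β) = ones (cP N) := by
  rw [cPW, Function.comp_apply, fanoutFn_apply, Function.comp_apply, fanoutFn_apply, Function.comp_apply, fanoutFn_apply, NW_apply, rlW_apply,
    KNW_apply, KW_apply, concatFn_boolPair, concatFn_boolPair, concatFn_boolPair, Com.ones_append, Com.ones_append, Com.ones_append, cP]
/-- Value of the unary helper on a genuine input. [folklore] -/
theorem LpW_apply : LpW kcP (winp N a β) = ones (P.Lp N) := by
  rw [LpW, Function.comp_apply, fanoutFn_apply, kkW_apply hS, cPW_apply, HashBricks.umulFn_boolPair, Lp]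
omit hS in
include hlp in
/-- Value of the unary helper on a genuine input. [folklore] -/
theorem LgW_apply : LgW f (winp N a β) = ones (Lg N) := by
  rw [LgW, Function.comp_apply, fanoutFn_apply, NW_apply, ← unary_eq_ones, LgU_apply hlp]
include hlp in
/-- Value of the unary helper on a genuine input. [folklore] -/
theorem fLenW_apply : fLenW f kcP (winp N a β) = ones (P.fLen N) := by
  rw [fLenW, Function.comp_apply, fanoutFn_apply, kkW_apply hS, LgW_apply hlp, HashBricks.umulFn_boolPair, fLen]
omit hS in
include hlp in
/-- Value of the unary helper on a genuine input. [folklore] -/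
theorem pubLenW_apply : pubLenW f (winp N a β) = ones (pubLen N) := by
  rw [pubLenW, Function.comp_apply, fanoutFn_apply, LgW_apply hlp, KNW_apply, concatFn_boolPair, Com.ones_append, pubLen]
omit hS in
include hlp in
/-- Value of the unary helper on a genuine input. [folklore] -/
theorem EBW_apply : EBW f (winp N a β) = ones (EB N) := by
  rw [EBW, Function.comp_apply, fanoutFn_apply, Function.comp_apply, fanoutFn_apply, Function.comp_apply, LgW_apply hlp,
    show true :: ones (Lg N) = ones (Lg N + 1) by simp [ones, List.replicate_succ], HashBricks.umulFn_boolPair, pow2bW_apply,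
    HashBricks.umulFn_boolPair, EB]
omit hS in
include hlp in
/-- Value of the unary helper on a genuine input. [folklore] -/
theorem teW_apply : teW f (winp N a β) = boolPair (ones (tOfA N a)) (ones (eOfA N a)) := by
  rw [teW, Function.comp_apply, fanoutFn_apply, EBW_apply hlp, aW_apply, divModFn_boolPair, tOfA, eOfA]
omit hS in
include hlp in
/-- Value of the unary helper on a genuine input. [folklore] -/
theorem tW_apply : tW f (winp N a β) = ones (tOfA N a) := by rw [tW, Function.comp_apply, teW_apply hlp, fstF_boolPair]
omit hS in
include hlp in
/-- Value of the unary helper on a genuine input. [folklore] -/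
theorem eW_apply : eW f (winp N a β) = ones (eOfA N a) := by rw [eW, Function.comp_apply, teW_apply hlp, sndF_boolPair]
include hlp in
/-- Value of the unary helper on a genuine input. [folklore] -/
theorem mlW_apply : mlW f mlenF (winp N a β) = ones (P.mlen N (tOfA N a)) := by
  rw [mlW, Function.comp_apply, fanoutFn_apply, NW_apply, tW_apply hlp, ← unary_eq_ones, ← unary_eq_ones, hS.mlenF_apply]
/-- Value of the unary helper on a genuine input. [folklore] -/
theorem kKW_apply : kKW kcP (winp N a β) = ones (P.kk N * kL N) := by
  rw [kKW, Function.comp_apply, fanoutFn_apply, kkW_apply hS, KW_apply, HashBricks.umulFn_boolPair]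
include hlp in
/-- Value of the unary helper on a genuine input. [folklore] -/
theorem uLW_apply : uLW f kcP mlenF (winp N a β) = ones (P.uLen N (tOfA N a)) := by
  rw [uLW, Function.comp_apply, fanoutFn_apply, Function.comp_apply, kKW_apply hS,
    show true :: ones (P.kk N * kL N) = ones (P.kk N * kL N + 1) by simp [ones, List.replicate_succ], mlW_apply hS hlp,
    HashBricks.umulFn_boolPair, uLen]
include hlp in
/-- Value of the unary helper on a genuine input. [folklore] -/
theorem kpW_apply : kpW f kcP (winp N a β) = ones (P.kk N * pubLen N) := by
  rw [kpW, Function.comp_apply, fanoutFn_apply, kkW_apply hS, pubLenW_apply hlp, HashBricks.umulFn_boolPair]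
include hlp in
/-- Value of the unary helper on a genuine input. [folklore] -/
theorem sLW_apply : sLW f kcP mlenF (winp N a β) = ones (P.sLen N (tOfA N a)) := by
  rw [sLW, Function.comp_apply, fanoutFn_apply, Function.comp_apply, fanoutFn_apply, mlW_apply hS hlp, kpW_apply hS hlp, uLW_apply hS hlp,
    concatFn_boolPair, concatFn_boolPair, Com.ones_append, Com.ones_append, sLen]
/-- Value of the unary helper on a genuine input. [folklore] -/
theorem slackW_apply : slackW kcP (winp N a β) = ones (P.slack N) := by
  rw [slackW, Function.comp_apply, Function.comp_apply, fanoutFn_apply, Function.comp_apply, fanoutFn_apply, pow2bW_apply,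
    HashBricks.umulFn_boolPair, kkW_apply hS, divModFn_boolPair, fstF_boolPair, slack]
include hlp in
/-- Value of the unary helper on a genuine input. [folklore] -/
theorem m3W_apply : m3W f kcP (winp N a β) = ones (P.m3 N a) := by
  rw [m3W, Function.comp_apply, fanoutFn_apply, twoN2W_apply, Function.comp_apply, fanoutFn_apply, slackW_apply hS, Function.comp_apply,
    Function.comp_apply, fanoutFn_apply, Function.comp_apply, fanoutFn_apply, pow2bW_apply, HashBricks.umulFn_boolPair, Function.comp_apply,
    fanoutFn_apply, Function.comp_apply, fanoutFn_apply, kkW_apply hS, eW_apply hlp, HashBricks.umulFn_boolPair, KW_apply,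
    HashBricks.umulFn_boolPair, divModFn_boolPair, fstF_boolPair, dropFn_boolPair, dropFn_boolPair, m3]
  simp only [ones, List.length_replicate, List.drop_replicate, pow_succ]
  congr 1
  rw [show 2 ^ bLen N * 2 * 2 = 4 * 2 ^ bLen N by ring]
/-- Value of the unary helper on a genuine input. [folklore] -/
theorem M13W_apply (hlp : IsLengthPreserving f) : M13W f kcP (winp N a β) = ones (P.M13 N a) := by
  rw [M13W]
  simp only [Function.comp_apply, fanoutFn_apply, twoN2W_apply, slackW_apply hS, pow2bW_apply, kKW_apply hS, tW_apply hlp, kkW_apply hS,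
    cW_apply, HashBricks.umulFn_boolPair, divModFn_boolPair, fstF_boolPair, concatFn_boolPair, Com.ones_append, dropFn_boolPair]
  simp only [ones, List.length_replicate, List.drop_replicate, M13, pow_succ]
  congr 1
  rw [show 2 ^ bLen N * 2 = 2 * 2 ^ bLen N by ring]
include hlp in
/-- Value of the unary helper on a genuine input. [folklore] -/
theorem m1W_apply : m1W f kcP (winp N a β) = ones (P.m1 N a) := by
  rw [m1W, Function.comp_apply, fanoutFn_apply, m3W_apply hS hlp, M13W_apply hS N a β hlp, dropFn_boolPair, m1]
  simp [ones, List.drop_replicate]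
include hlp in
/-- Value of the unary helper on a genuine input. [folklore] -/
theorem key1W_apply : key1W f kcP (winp N a β) = ones (P.key1 N a) := by
  rw [key1W, Function.comp_apply, fanoutFn_apply, m1W_apply hS hlp, Function.comp_apply, LpW_apply hS,
    show true :: ones (P.Lp N) = ones (P.Lp N + 1) by simp [ones, List.replicate_succ], HashBricks.umulFn_boolPair, key1]
include hlp in
/-- Value of the unary helper on a genuine input. [folklore] -/
theorem key3W_apply : key3W f kcP (winp N a β) = ones (P.key3 N a) := by
  rw [key3W, Function.comp_apply, fanoutFn_apply, m3W_apply hS hlp, Function.comp_apply, fLenW_apply hS hlp,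
    show true :: ones (P.fLen N) = ones (P.fLen N + 1) by simp [ones, List.replicate_succ], HashBricks.umulFn_boolPair, key3]

end Values

/-! ### The slices of `β = α ‖ R` -/

variable (f kcP mlenF)

/-- `α = β ↾ sLen`. [folklore] -/
noncomputable def alphaW : List Bool → List Bool := takeFn ∘ fanoutFn (sLW f kcP mlenF) bW
/-- `R = β ⇂ sLen`. [folklore] -/
noncomputable def RW : List Bool → List Bool := dropFn ∘ fanoutFn (sLW f kcP mlenF) bW
/-- `v₂ = α ↾ mlen`. [folklore] -/
noncomputable def v2W : List Bool → List Bool := takeFn ∘ fanoutFn (mlW f mlenF) (alphaW f kcP mlenF)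
/-- `pubs = (α ⇂ mlen) ↾ k·pubLen`. [folklore] -/
noncomputable def pubsW : List Bool → List Bool := takeFn ∘ fanoutFn (kpW f kcP) (dropFn ∘ fanoutFn (mlW f mlenF) (alphaW f kcP mlenF))
/-- `U = α ⇂ (mlen + k·pubLen)`. [folklore] -/
noncomputable def UW : List Bool → List Bool := dropFn ∘ fanoutFn (concatFn ∘ fanoutFn (mlW f mlenF) (kpW f kcP)) (alphaW f kcP mlenF)
/-- `Z₁ = R ↾ m₁`. [folklore] -/
noncomputable def Z1W : List Bool → List Bool := takeFn ∘ fanoutFn (m1W f kcP) (RW f kcP mlenF)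
/-- `U₁ = (R ⇂ m₁) ↾ |U₁|`. [folklore] -/
noncomputable def U1W : List Bool → List Bool := takeFn ∘ fanoutFn (key1W f kcP) (dropFn ∘ fanoutFn (m1W f kcP) (RW f kcP mlenF))
/-- `U₃ = R ⇂ (m₁ + |U₁|)`. [folklore] -/
noncomputable def U3W : List Bool → List Bool := dropFn ∘ fanoutFn (concatFn ∘ fanoutFn (m1W f kcP) (key1W f kcP)) (RW f kcP mlenF)

/-! ### `F'(pubs)` and `Y'(pubs)` by counted folds -/

/-- Block `i` of `pubs`, on `⟨w, 1ⁱ⟩`. [folklore] -/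
noncomputable def pubBlkW : List Bool → List Bool :=
  takeFn ∘ fanoutFn (pubLenW f ∘ fstF) (dropFn ∘ fanoutFn (HashBricks.umulFn ∘ fanoutFn sndF (pubLenW f ∘ fstF)) (pubsW f kcP mlenF ∘ fstF))
/-- The `F'`-piece of block `i`: its first `Lg` bits. [folklore] -/
noncomputable def pieceFW : List Bool → List Bool := takeFn ∘ fanoutFn (LgW f ∘ fstF) (pubBlkW f kcP mlenF)
/-- The `Y'`-piece of block `i`: the rest. [folklore] -/
noncomputable def pieceYW : List Bool → List Bool := dropFn ∘ fanoutFn (LgW f ∘ fstF) (pubBlkW f kcP mlenF)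
/-- The initial fold record `⟨w, ⟨bin k, ⟨1⁰, ε⟩⟩⟩`. [folklore] -/
noncomputable def initW : List Bool → List Bool := fanoutFn id (fanoutFn (lenBinF ∘ kkW kcP) (fun _ => boolPair [] []))
/-- **The program of `F'(pubs)`.** [folklore] -/
noncomputable def fOfPubsW : List Bool → List Bool := sndPow 2 ∘ foldLoop appF (clipF 1 (pieceFW f kcP mlenF)) (kcP ^ 3) ∘ initW kcP
/-- **The program of `Y'(pubs)`.** [folklore] -/
noncomputable def yOfPubsW : List Bool → List Bool := sndPow 2 ∘ foldLoop appF (clipF 1 (pieceYW f kcP mlenF)) (kcP ^ 3) ∘ initW kcP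
/-- `h₃ = hashStr fLen m₃ U₃ F'`. [folklore] -/
noncomputable def h3W : List Bool → List Bool :=
  AffineProg.hashFn ∘ fanoutFn (fanoutFn (fLenW f kcP) (m3W f kcP)) (fanoutFn (U3W f kcP mlenF) (fOfPubsW f kcP mlenF))
/-- **The simulator `Φ` as a program**: `lay U₃ Y' h₃ U v₂ Z₁ U₁`. [cite: HastadImpagliazzoLevinLuby1999, Thm 7.0.5 (proof, step (2))] -/
noncomputable def phiF : List Bool → List Bool :=
  concatFn ∘ fanoutFn (concatFn ∘ fanoutFn (concatFn ∘ fanoutFn (concatFn ∘ fanoutFn (concatFn ∘ fanoutFn (concatFn ∘ fanoutFn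
    (U3W f kcP mlenF) (yOfPubsW f kcP mlenF)) (h3W f kcP mlenF)) (UW f kcP mlenF)) (v2W f kcP mlenF)) (Z1W f kcP mlenF)) (U1W f kcP mlenF)

variable {f kcP mlenF}

section PhiValues

variable (hS : ProgSpec P kcP mlenF) (hlp : IsLengthPreserving f) (N a : ℕ) (β : List Bool)
include hS hlp

/-- The mathematical slices of `β`. [folklore] -/
theorem slices_apply :
    let t := tOfA N a
    let α := β.take (P.sLen N t)
    let R := β.drop (P.sLen N t)
    alphaW f kcP mlenF (winp N a β) = α ∧ RW f kcP mlenF (winp N a β) = R ∧ v2W f kcP mlenF (winp N a β) = α.take (P.mlen N t) ∧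
      pubsW f kcP mlenF (winp N a β) = (α.drop (P.mlen N t)).take (P.kk N * pubLen N) ∧
      UW f kcP mlenF (winp N a β) = α.drop (P.mlen N t + P.kk N * pubLen N) ∧
      Z1W f kcP mlenF (winp N a β) = R.take (P.m1 N a) ∧ U1W f kcP mlenF (winp N a β) = (R.drop (P.m1 N a)).take (P.key1 N a) ∧
      U3W f kcP mlenF (winp N a β) = R.drop (P.m1 N a + P.key1 N a) := by
  intro t α R
  have hα : alphaW f kcP mlenF (winp N a β) = α := by
    rw [alphaW, Function.comp_apply, fanoutFn_apply, sLW_apply hS hlp, bW_apply, takeFn_boolPair]; simp [ones, α, t]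
  have hR : RW f kcP mlenF (winp N a β) = R := by
    rw [RW, Function.comp_apply, fanoutFn_apply, sLW_apply hS hlp, bW_apply, dropFn_boolPair]; simp [ones, R, t]
  refine ⟨hα, hR, ?_, ?_, ?_, ?_, ?_, ?_⟩
  · rw [v2W, Function.comp_apply, fanoutFn_apply, mlW_apply hS hlp, hα, takeFn_boolPair]; simp [ones, t]
  · rw [pubsW, Function.comp_apply, fanoutFn_apply, kpW_apply hS hlp, Function.comp_apply, fanoutFn_apply, mlW_apply hS hlp, hα, dropFn_boolPair,
      takeFn_boolPair]; simp [ones, t]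
  · rw [UW, Function.comp_apply, fanoutFn_apply, Function.comp_apply, fanoutFn_apply, mlW_apply hS hlp, kpW_apply hS hlp, concatFn_boolPair,
      Com.ones_append, hα, dropFn_boolPair]; simp [ones, t]
  · rw [Z1W, Function.comp_apply, fanoutFn_apply, m1W_apply hS hlp, hR, takeFn_boolPair]; simp [ones]
  · rw [U1W, Function.comp_apply, fanoutFn_apply, key1W_apply hS hlp, Function.comp_apply, fanoutFn_apply, m1W_apply hS hlp, hR, dropFn_boolPair,
      takeFn_boolPair]; simp [ones]
  · rw [U3W, Function.comp_apply, fanoutFn_apply, Function.comp_apply, fanoutFn_apply, m1W_apply hS hlp, key1W_apply hS hlp, concatFn_boolPair,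
      Com.ones_append, hR, dropFn_boolPair]; simp [ones]

/-- The pieces of the folds on `⟨w, 1ⁱ⟩`. [folklore] -/
theorem pieces_apply (i : ℕ) :
    let pubs := ((β.take (P.sLen N (tOfA N a))).drop (P.mlen N (tOfA N a))).take (P.kk N * pubLen N)
    pieceFW f kcP mlenF (boolPair (winp N a β) (ones i)) = (Greedy.blkL (pubLen N) i pubs).take (Lg N) ∧
      pieceYW f kcP mlenF (boolPair (winp N a β) (ones i)) = (Greedy.blkL (pubLen N) i pubs).drop (Lg N) := by
  intro pubs
  obtain ⟨-, -, -, hp, -⟩ := slices_apply hS hlp N a β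
  have hblk : pubBlkW f kcP mlenF (boolPair (winp N a β) (ones i)) = Greedy.blkL (pubLen N) i pubs := by
    rw [pubBlkW, Function.comp_apply, fanoutFn_apply, Function.comp_apply, fstF_boolPair, pubLenW_apply hlp, Function.comp_apply, fanoutFn_apply,
      Function.comp_apply, fanoutFn_apply, sndF_boolPair, Function.comp_apply, fstF_boolPair, pubLenW_apply hlp, HashBricks.umulFn_boolPair,
      Function.comp_apply, fstF_boolPair, hp, dropFn_boolPair, takeFn_boolPair]
    simp [ones, Greedy.blkL, pubs]
  constructor
  · rw [pieceFW, Function.comp_apply, fanoutFn_apply, Function.comp_apply, fstF_boolPair, LgW_apply hlp, hblk, takeFn_boolPair]; simp [ones]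
  · rw [pieceYW, Function.comp_apply, fanoutFn_apply, Function.comp_apply, fstF_boolPair, LgW_apply hlp, hblk, dropFn_boolPair]; simp [ones]

omit hS hlp in
/-- `|winp| = 2N + 2 + 2a + 2 + |β|`. [folklore] -/
theorem length_winp : (winp N a β).length = 2 * N + 2 + (2 * a + 2 + β.length) := by
  simp only [winp, length_boolPair, length_unary, ones, List.length_replicate]

set_option maxHeartbeats 800000 in
/-- **Values of the two folds** (`pubLen N ≤ |β|`). [folklore] -/
theorem folds_apply (hβ : pubLen N ≤ β.length) :
    let pubs := ((β.take (P.sLen N (tOfA N a))).drop (P.mlen N (tOfA N a))).take (P.kk N * pubLen N)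
    fOfPubsW f kcP mlenF (winp N a β) = P.fOfPubs N pubs ∧ yOfPubsW f kcP mlenF (winp N a β) = P.yOfPubs N pubs := by
  intro pubs
  have hinit : initW kcP (winp N a β) = boolPair (winp N a β) (boolPair (encodeNat (P.kk N)) (boolPair (ones 0) [])) := by
    rw [initW, fanoutFn_apply, fanoutFn_apply, id, Function.comp_apply, kkW_apply hS, lenBinF_apply]; simp [ones]
  have hlen := length_winp N a β
  have hkM : P.kk N ≤ (kcP ^ 3).eval (winp N a β).length := by
    rw [hS.kk_eq]; exact TM2Iter.eval_mono _ (by rw [hlen]; omega)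
  have hblk : ∀ j, (Greedy.blkL (pubLen N) j pubs).length ≤ pubLen N := fun j => by rw [Greedy.blkL]; exact List.length_take_le _ _
  have hw : β.length ≤ (winp N a β).length + 1 := by rw [hlen]; omega
  have hpF : ∀ j, 0 ≤ j → j < 0 + P.kk N → (pieceFW f kcP mlenF (boolPair (winp N a β) (ones j))).length ≤ 1 * ((winp N a β).length + 1) := by
    intro j _ _
    rw [(pieces_apply hS hlp N a β j).1, one_mul]
    exact (by rw [List.length_take]; exact min_le_right _ _ : ((Greedy.blkL (pubLen N) j pubs).take (Lg N)).length ≤ (Greedy.blkL (pubLen N) j pubs).length).trans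
      ((hblk j).trans (hβ.trans hw))
  have hpY : ∀ j, 0 ≤ j → j < 0 + P.kk N → (pieceYW f kcP mlenF (boolPair (winp N a β) (ones j))).length ≤ 1 * ((winp N a β).length + 1) := by
    intro j _ _
    rw [(pieces_apply hS hlp N a β j).2, one_mul, List.length_drop]
    exact (Nat.sub_le _ _).trans ((hblk j).trans (hβ.trans hw))
  constructor
  · rw [fOfPubsW, Function.comp_apply, Function.comp_apply, hinit, foldLoop_apply _ _ hkM 0, sndPow_succ_boolPair, sndPow_succ_boolPair,
      sndPow_zero_boolPair, foldAcc_clipF hpF, foldAcc_appF, List.nil_append, Hybrid.ccat_eq_flatten_range, fOfPubs]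
    exact congrArg List.flatten (List.map_congr_left fun i _ => by rw [zero_add, (pieces_apply hS hlp N a β i).1])
  · rw [yOfPubsW, Function.comp_apply, Function.comp_apply, hinit, foldLoop_apply _ _ hkM 0, sndPow_succ_boolPair, sndPow_succ_boolPair,
      sndPow_zero_boolPair, foldAcc_clipF hpY, foldAcc_appF, List.nil_append, Hybrid.ccat_eq_flatten_range, yOfPubs]
    exact congrArg List.flatten (List.map_congr_left fun i _ => by rw [zero_add, (pieces_apply hS hlp N a β i).2])

/-- **Value of the simulator program**: `phiF ⟨1^N, ⟨1^a, β⟩⟩ = phiStr N a β` (`pubLen N ≤ |β|`).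
[cite: HastadImpagliazzoLevinLuby1999, Thm 7.0.5 (proof, step (2))] -/
theorem phiF_apply (hβ : pubLen N ≤ β.length) : phiF f kcP mlenF (winp N a β) = P.phiStr N a β := by
  obtain ⟨-, -, hv2, hp, hU, hZ1, hU1, hU3⟩ := slices_apply hS hlp N a β
  obtain ⟨hF, hY⟩ := folds_apply hS hlp N a β hβ
  have hh3 : h3W f kcP mlenF (winp N a β) = hashStr (P.fLen N) (P.m3 N a) (β.drop (P.sLen N (tOfA N a)) |>.drop (P.m1 N a + P.key1 N a))
      (P.fOfPubs N (((β.take (P.sLen N (tOfA N a))).drop (P.mlen N (tOfA N a))).take (P.kk N * pubLen N))) := by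
    rw [h3W, Function.comp_apply, fanoutFn_apply, fanoutFn_apply, fanoutFn_apply, fLenW_apply hS hlp, m3W_apply hS hlp, hU3, hF, AffineProg.hashFn_boolPair]
  rw [phiF]
  simp only [Function.comp_apply, fanoutFn_apply, concatFn_boolPair, hU3, hY, hh3, hU, hv2, hZ1, hU1]
  rfl

end PhiValues

/-! ### Membership in `FP` -/

section Membership

variable (hS : ProgSpec P kcP mlenF) (hf : f ∈ FP)
include hS hf

set_option maxHeartbeats 800000 in
/-- **All the unary helpers, the slices, the folds and `Φ` are in `FP`.** [cite: AroraBarak2009, §1.3] -/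
theorem phiF_mem_FP : phiF f kcP mlenF ∈ FP ∧ m1W f kcP ∈ FP ∧ LpW kcP ∈ FP ∧ uLW f kcP mlenF ∈ FP ∧ key1W f kcP ∈ FP ∧ tW f ∈ FP ∧ NW ∈ FP := by
  have hN : NW ∈ FP := fstF_mem_FP
  have ha : aW ∈ FP := comp_mem_FP fstF_mem_FP sndF_mem_FP
  have hb : bW ∈ FP := comp_mem_FP sndF_mem_FP sndF_mem_FP
  have hK : KW ∈ FP := comp_mem_FP logFn_mem_FP hN
  have h2N : twoN2W ∈ FP := comp_mem_FP (polyFn_mem_FP _) hN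
  have hp2 : pow2bW ∈ FP := comp_mem_FP (cons_mem_FP true) (comp_mem_FP binToUnaryFn_mem_FP (fanoutFn_mem_FP h2N (comp_mem_FP (cons_mem_FP true) hK)))
  have hkk : kkW kcP ∈ FP := comp_mem_FP (polyFn_mem_FP _) hN
  have hrl : rlW ∈ FP := comp_mem_FP (polyFn_mem_FP _) hN
  have hKN : KNW ∈ FP := comp_mem_FP HashBricks.umulFn_mem_FP (fanoutFn_mem_FP hK hN)
  have hc : cW ∈ FP := comp_mem_FP concatFn_mem_FP (fanoutFn_mem_FP (comp_mem_FP concatFn_mem_FP (fanoutFn_mem_FP hN hrl)) hK)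
  have hcP : cPW ∈ FP := comp_mem_FP concatFn_mem_FP (fanoutFn_mem_FP (comp_mem_FP concatFn_mem_FP (fanoutFn_mem_FP
    (comp_mem_FP concatFn_mem_FP (fanoutFn_mem_FP hN hrl)) hKN)) hK)
  have hLp : LpW kcP ∈ FP := comp_mem_FP HashBricks.umulFn_mem_FP (fanoutFn_mem_FP hkk hcP)
  have hLg : LgW f ∈ FP := comp_mem_FP (LgU_mem_FP hf) (fanoutFn_mem_FP hN hN)
  have hfL : fLenW f kcP ∈ FP := comp_mem_FP HashBricks.umulFn_mem_FP (fanoutFn_mem_FP hkk hLg)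
  have hpL : pubLenW f ∈ FP := comp_mem_FP concatFn_mem_FP (fanoutFn_mem_FP hLg hKN)
  have hEB : EBW f ∈ FP := comp_mem_FP HashBricks.umulFn_mem_FP (fanoutFn_mem_FP (comp_mem_FP HashBricks.umulFn_mem_FP
    (fanoutFn_mem_FP (const_mem_FP _) (comp_mem_FP (cons_mem_FP true) hLg))) hp2)
  have hte : teW f ∈ FP := comp_mem_FP divModFn_mem_FP (fanoutFn_mem_FP hEB ha)
  have ht : tW f ∈ FP := comp_mem_FP fstF_mem_FP hte
  have he : eW f ∈ FP := comp_mem_FP sndF_mem_FP hte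
  have hml : mlW f mlenF ∈ FP := comp_mem_FP hS.mlenF_mem (fanoutFn_mem_FP hN ht)
  have hkK : kKW kcP ∈ FP := comp_mem_FP HashBricks.umulFn_mem_FP (fanoutFn_mem_FP hkk hK)
  have huL : uLW f kcP mlenF ∈ FP := comp_mem_FP HashBricks.umulFn_mem_FP (fanoutFn_mem_FP (comp_mem_FP (cons_mem_FP true) hkK) hml)
  have hkp : kpW f kcP ∈ FP := comp_mem_FP HashBricks.umulFn_mem_FP (fanoutFn_mem_FP hkk hpL)
  have hsL : sLW f kcP mlenF ∈ FP := comp_mem_FP concatFn_mem_FP (fanoutFn_mem_FP (comp_mem_FP concatFn_mem_FP (fanoutFn_mem_FP hml hkp)) huL)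
  have hsl : slackW kcP ∈ FP := comp_mem_FP fstF_mem_FP (comp_mem_FP divModFn_mem_FP (fanoutFn_mem_FP
    (comp_mem_FP HashBricks.umulFn_mem_FP (fanoutFn_mem_FP (const_mem_FP _) hp2)) hkk))
  have hm3 : m3W f kcP ∈ FP := comp_mem_FP dropFn_mem_FP (fanoutFn_mem_FP h2N (comp_mem_FP dropFn_mem_FP (fanoutFn_mem_FP hsl
    (comp_mem_FP fstF_mem_FP (comp_mem_FP divModFn_mem_FP (fanoutFn_mem_FP (comp_mem_FP HashBricks.umulFn_mem_FP (fanoutFn_mem_FP (const_mem_FP _) hp2))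
      (comp_mem_FP HashBricks.umulFn_mem_FP (fanoutFn_mem_FP (comp_mem_FP HashBricks.umulFn_mem_FP (fanoutFn_mem_FP hkk he)) hK))))))))
  have hM : M13W f kcP ∈ FP := comp_mem_FP dropFn_mem_FP (fanoutFn_mem_FP (const_mem_FP _) (comp_mem_FP dropFn_mem_FP (fanoutFn_mem_FP
    (comp_mem_FP HashBricks.umulFn_mem_FP (fanoutFn_mem_FP (const_mem_FP _) h2N)) (comp_mem_FP dropFn_mem_FP (fanoutFn_mem_FP
    (comp_mem_FP HashBricks.umulFn_mem_FP (fanoutFn_mem_FP (const_mem_FP _) hsl)) (comp_mem_FP dropFn_mem_FP (fanoutFn_mem_FP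
    (comp_mem_FP fstF_mem_FP (comp_mem_FP divModFn_mem_FP (fanoutFn_mem_FP hp2 (comp_mem_FP HashBricks.umulFn_mem_FP (fanoutFn_mem_FP hkK ht)))))
    (comp_mem_FP concatFn_mem_FP (fanoutFn_mem_FP (comp_mem_FP HashBricks.umulFn_mem_FP (fanoutFn_mem_FP hkk hc))
      (comp_mem_FP fstF_mem_FP (comp_mem_FP divModFn_mem_FP (fanoutFn_mem_FP (comp_mem_FP HashBricks.umulFn_mem_FP (fanoutFn_mem_FP (const_mem_FP _) hp2)) hkK))))))))))))
  have hm1 : m1W f kcP ∈ FP := comp_mem_FP dropFn_mem_FP (fanoutFn_mem_FP hm3 hM)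
  have hk1 : key1W f kcP ∈ FP := comp_mem_FP HashBricks.umulFn_mem_FP (fanoutFn_mem_FP hm1 (comp_mem_FP (cons_mem_FP true) hLp))
  have hk3 : key3W f kcP ∈ FP := comp_mem_FP HashBricks.umulFn_mem_FP (fanoutFn_mem_FP hm3 (comp_mem_FP (cons_mem_FP true) hfL))
  -- slices
  have hα : alphaW f kcP mlenF ∈ FP := comp_mem_FP takeFn_mem_FP (fanoutFn_mem_FP hsL hb)
  have hR : RW f kcP mlenF ∈ FP := comp_mem_FP dropFn_mem_FP (fanoutFn_mem_FP hsL hb)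
  have hv2 : v2W f kcP mlenF ∈ FP := comp_mem_FP takeFn_mem_FP (fanoutFn_mem_FP hml hα)
  have hpubs : pubsW f kcP mlenF ∈ FP := comp_mem_FP takeFn_mem_FP (fanoutFn_mem_FP hkp (comp_mem_FP dropFn_mem_FP (fanoutFn_mem_FP hml hα)))
  have hU : UW f kcP mlenF ∈ FP := comp_mem_FP dropFn_mem_FP (fanoutFn_mem_FP (comp_mem_FP concatFn_mem_FP (fanoutFn_mem_FP hml hkp)) hα)
  have hZ1 : Z1W f kcP mlenF ∈ FP := comp_mem_FP takeFn_mem_FP (fanoutFn_mem_FP hm1 hR)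
  have hU1 : U1W f kcP mlenF ∈ FP := comp_mem_FP takeFn_mem_FP (fanoutFn_mem_FP hk1 (comp_mem_FP dropFn_mem_FP (fanoutFn_mem_FP hm1 hR)))
  have hU3 : U3W f kcP mlenF ∈ FP := comp_mem_FP dropFn_mem_FP (fanoutFn_mem_FP (comp_mem_FP concatFn_mem_FP (fanoutFn_mem_FP hm1 hk1)) hR)
  -- folds
  have hblk : pubBlkW f kcP mlenF ∈ FP := comp_mem_FP takeFn_mem_FP (fanoutFn_mem_FP (comp_mem_FP hpL fstF_mem_FP)
    (comp_mem_FP dropFn_mem_FP (fanoutFn_mem_FP (comp_mem_FP HashBricks.umulFn_mem_FP (fanoutFn_mem_FP sndF_mem_FP (comp_mem_FP hpL fstF_mem_FP)))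
      (comp_mem_FP hpubs fstF_mem_FP))))
  have hpF : pieceFW f kcP mlenF ∈ FP := comp_mem_FP takeFn_mem_FP (fanoutFn_mem_FP (comp_mem_FP hLg fstF_mem_FP) hblk)
  have hpY : pieceYW f kcP mlenF ∈ FP := comp_mem_FP dropFn_mem_FP (fanoutFn_mem_FP (comp_mem_FP hLg fstF_mem_FP) hblk)
  have hinit : initW kcP ∈ FP := fanoutFn_mem_FP (PolyTimeComputable.id _) (fanoutFn_mem_FP (comp_mem_FP lenBinF_mem_FP hkk) (const_mem_FP _))
  have hfold : fOfPubsW f kcP mlenF ∈ FP := comp_mem_FP (sndPow_mem_FP 2) (comp_mem_FP (foldLoop_clipF_mem_FP 1 appF_mem_FP length_appF_le hpF _) hinit)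
  have hyold : yOfPubsW f kcP mlenF ∈ FP := comp_mem_FP (sndPow_mem_FP 2) (comp_mem_FP (foldLoop_clipF_mem_FP 1 appF_mem_FP length_appF_le hpY _) hinit)
  have hh3 : h3W f kcP mlenF ∈ FP := comp_mem_FP AffineProg.hashFn_mem_FP (fanoutFn_mem_FP (fanoutFn_mem_FP hfL hm3) (fanoutFn_mem_FP hU3 hfold))
  refine ⟨?_, hm1, hLp, huL, hk1, ht, hN⟩
  exact comp_mem_FP concatFn_mem_FP (fanoutFn_mem_FP (comp_mem_FP concatFn_mem_FP (fanoutFn_mem_FP (comp_mem_FP concatFn_mem_FP (fanoutFn_mem_FP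
    (comp_mem_FP concatFn_mem_FP (fanoutFn_mem_FP (comp_mem_FP concatFn_mem_FP (fanoutFn_mem_FP (comp_mem_FP concatFn_mem_FP (fanoutFn_mem_FP hU3 hyold)) hh3)) hU))
    hv2)) hZ1)) hU1)

end Membership

/-! ### The generator core as a program -/

variable (f kcP mlenF) (dP : Polynomial ℕ)

/-- `pcs = s ↾ Lp`. [folklore] -/
noncomputable def pcsS : List Bool → List Bool := takeFn ∘ fanoutFn (LpW kcP) bW
/-- `U = (s ⇂ Lp) ↾ uLen`. [folklore] -/
noncomputable def US : List Bool → List Bool := takeFn ∘ fanoutFn (uLW f kcP mlenF) (dropFn ∘ fanoutFn (LpW kcP) bW)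
/-- `U₁`. [folklore] -/
noncomputable def U1S : List Bool → List Bool :=
  takeFn ∘ fanoutFn (key1W f kcP) (dropFn ∘ fanoutFn (concatFn ∘ fanoutFn (LpW kcP) (uLW f kcP mlenF)) bW)
/-- `1^{Lp + uLen + |U₁|}`. [folklore] -/
noncomputable def pre3W : List Bool → List Bool := concatFn ∘ fanoutFn (concatFn ∘ fanoutFn (LpW kcP) (uLW f kcP mlenF)) (key1W f kcP)
/-- `1^{coreLen}`. [folklore] -/
noncomputable def coreLenW : List Bool → List Bool := concatFn ∘ fanoutFn (pre3W f kcP mlenF) (key3W f kcP)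
/-- `U₃ = (s ⇂ (Lp + uLen + |U₁|)) ↾ |U₃|`. [folklore] -/
noncomputable def U3S : List Bool → List Bool := takeFn ∘ fanoutFn (key3W f kcP) (dropFn ∘ fanoutFn (pre3W f kcP mlenF) bW)
/-- The rest of the seed (passed through). [folklore] -/
noncomputable def restS : List Bool → List Bool := dropFn ∘ fanoutFn (coreLenW f kcP mlenF) bW
/-- The sampler record `srec N t [] false [] pcs U []`. [folklore] -/
noncomputable def recS : List Bool → List Bool :=
  fanoutFn (fanoutFn NW (tW f)) (fanoutFn (fun _ => []) (fanoutFn (fanoutFn (fun _ => [false]) (fun _ => [])) (fanoutFn (pcsS kcP)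
    (fanoutFn (US f kcP mlenF) (fun _ => [])))))
/-- `h₁ = hashStr Lp m₁ U₁ pcs`. [folklore] -/
noncomputable def h1S : List Bool → List Bool := AffineProg.hashFn ∘ fanoutFn (fanoutFn (LpW kcP) (m1W f kcP)) (fanoutFn (U1S f kcP mlenF) (pcsS kcP))
/-- `β' = 𝒟-sample ‖ (h₁ ‖ U₁ ‖ U₃)`. [folklore] -/
noncomputable def betaS : List Bool → List Bool :=
  concatFn ∘ fanoutFn (DsampleF f kcP mlenF ∘ recS f kcP mlenF) (concatFn ∘ fanoutFn (concatFn ∘ fanoutFn (h1S f kcP mlenF) (U1S f kcP mlenF)) (U3S f kcP mlenF))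
/-- **The core output** `Φ⟨1^N, ⟨1^a, β'⟩⟩`. [cite: HastadImpagliazzoLevinLuby1999, Construction 7.0.4] -/
noncomputable def coreS : List Bool → List Bool := phiF f kcP mlenF ∘ fanoutFn NW (fanoutFn aW (betaS f kcP mlenF))
/-- **The generator program** `⟨1^N, ⟨1^a, s⟩⟩ ↦ (core ‖ rest ‖ 0…) ↾ (d(N)+1)`. [cite: HastadImpagliazzoLevinLuby1999, Construction 7.0.4 with Prop. 4.8.1] -/
noncomputable def genF : List Bool → List Bool :=
  takeFn ∘ fanoutFn (polyFn (dP + 1) ∘ NW) (concatFn ∘ fanoutFn (concatFn ∘ fanoutFn (coreS f kcP mlenF) (restS f kcP mlenF))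
    (Kannan.zerosFn ∘ polyFn (dP + 1) ∘ NW))

variable {f kcP mlenF dP}

/-- Pad with zeros and truncate to length `L`. [folklore] -/
def takePad (L : ℕ) (x : List Bool) : List Bool := (x ++ List.replicate L false).take L

/-- `|takePad L x| = L`. [folklore] -/
theorem length_takePad (L : ℕ) (x : List Bool) : (takePad L x).length = L := by
  rw [takePad, List.length_take, List.length_append, List.length_replicate]; omega

/-- `takePad` is truncation on long strings. [folklore] -/
theorem takePad_eq_take {L : ℕ} {x : List Bool} (h : L ≤ x.length) : takePad L x = x.take L := by
  rw [takePad, List.take_append_of_le_length h]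

/-- **Value of the simulator on `𝒟`-sample ‖ R`** at any advice. [folklore] -/
theorem phiStr_Dsample_gen (hlp : IsLengthPreserving f) (N a : ℕ) {pcs U Z1 U1 U3 : List Bool}
    (hpcs : pcs.length = P.Lp N) (hU : U.length = P.uLen N (tOfA N a)) (hZ1 : Z1.length = P.m1 N a) (hU1 : U1.length = P.key1 N a) :
    P.phiStr N a (P.Dsample f N (tOfA N a) [] false [] pcs U ++ (Z1 ++ U1 ++ U3)) =
      lay U3 (P.yprimes N pcs) (hashStr (P.fLen N) (P.m3 N a) U3 (P.fprimes f N pcs)) U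
        (hashStr (P.kk N * kL N) (P.mlen N (tOfA N a)) U (P.blocks N [] false [] pcs)) Z1 U1 := by
  have hD : (P.Dsample f N (tOfA N a) [] false [] pcs U).length = P.sLen N (tOfA N a) :=
    length_Dsample hlp (τ := []) (by simp) (fun h => absurd h Bool.false_ne_true) hpcs hU
  have hpubs : (P.pubs f N [] false [] pcs).length = P.kk N * pubLen N := length_pubs hlp (τ := []) (by simp) (fun h => absurd h Bool.false_ne_true) hpcs
  have hh : (hashStr (P.kk N * kL N) (P.mlen N (tOfA N a)) U (P.blocks N [] false [] pcs)).length = P.mlen N (tOfA N a) := length_hashStr _ _ _ _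
  simp only [phiStr]
  rw [List.take_append_of_le_length hD.ge, List.take_of_length_le hD.le, List.drop_append_of_le_length hD.ge, List.drop_of_length_le hD.le,
    List.nil_append]
  have e1 : (P.Dsample f N (tOfA N a) [] false [] pcs U).take (P.mlen N (tOfA N a)) = hashStr (P.kk N * kL N) (P.mlen N (tOfA N a)) U (P.blocks N [] false [] pcs) := by
    rw [Dsample, List.append_assoc, List.take_append_of_le_length hh.ge, List.take_of_length_le hh.le]
  have e2 : ((P.Dsample f N (tOfA N a) [] false [] pcs U).drop (P.mlen N (tOfA N a))).take (P.kk N * pubLen N) = P.pubs f N [] false [] pcs := by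
    rw [Dsample, List.append_assoc, List.drop_append_of_le_length hh.ge, List.drop_of_length_le hh.le, List.nil_append,
      List.take_append_of_le_length hpubs.ge, List.take_of_length_le hpubs.le]
  have e3 : (P.Dsample f N (tOfA N a) [] false [] pcs U).drop (P.mlen N (tOfA N a) + P.kk N * pubLen N) = U := by
    rw [Dsample, List.drop_append_of_le_length (by rw [List.length_append, hh, hpubs]), List.drop_of_length_le (by rw [List.length_append, hh, hpubs]),
      List.nil_append]
  have e4 : (Z1 ++ U1 ++ U3).take (P.m1 N a) = Z1 := by
    rw [List.append_assoc, List.take_append_of_le_length hZ1.ge, List.take_of_length_le hZ1.le]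
  have e5 : ((Z1 ++ U1 ++ U3).drop (P.m1 N a)).take (P.key1 N a) = U1 := by
    rw [List.append_assoc, List.drop_append_of_le_length hZ1.ge, List.drop_of_length_le hZ1.le, List.nil_append,
      List.take_append_of_le_length hU1.ge, List.take_of_length_le hU1.le]
  have e6 : (Z1 ++ U1 ++ U3).drop (P.m1 N a + P.key1 N a) = U3 := by
    rw [List.drop_append_of_le_length (by rw [List.length_append, hZ1, hU1]), List.drop_of_length_le (by rw [List.length_append, hZ1, hU1]), List.nil_append]
  rw [e1, e2, e3, e4, e5, e6, fOfPubs_pubs hlp hpcs, yOfPubs_pubs hlp hpcs]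

section GenValues

variable (hS : ProgSpec P kcP mlenF) (hlp : IsLengthPreserving f) (N a : ℕ) (s : List Bool)
include hS hlp

/-- The seed slices. [folklore] -/
theorem seed_slices_apply :
    pcsS kcP (winp N a s) = s.take (P.Lp N) ∧ US f kcP mlenF (winp N a s) = (s.drop (P.Lp N)).take (P.uLen N (tOfA N a)) ∧
      U1S f kcP mlenF (winp N a s) = (s.drop (P.Lp N + P.uLen N (tOfA N a))).take (P.key1 N a) ∧
      U3S f kcP mlenF (winp N a s) = (s.drop (P.Lp N + P.uLen N (tOfA N a) + P.key1 N a)).take (P.key3 N a) ∧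
      restS f kcP mlenF (winp N a s) = s.drop (P.coreLen N a) := by
  have h3 : pre3W f kcP mlenF (winp N a s) = ones (P.Lp N + P.uLen N (tOfA N a) + P.key1 N a) := by
    rw [pre3W, Function.comp_apply, fanoutFn_apply, Function.comp_apply, fanoutFn_apply, LpW_apply hS, uLW_apply hS hlp, key1W_apply hS hlp,
      concatFn_boolPair, concatFn_boolPair, Com.ones_append, Com.ones_append]
  have hc : coreLenW f kcP mlenF (winp N a s) = ones (P.coreLen N a) := by
    rw [coreLenW, Function.comp_apply, fanoutFn_apply, h3, key3W_apply hS hlp, concatFn_boolPair, Com.ones_append, coreLen]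
  refine ⟨?_, ?_, ?_, ?_, ?_⟩
  · rw [pcsS, Function.comp_apply, fanoutFn_apply, LpW_apply hS, bW_apply, takeFn_boolPair]; simp [ones]
  · rw [US, Function.comp_apply, fanoutFn_apply, uLW_apply hS hlp, Function.comp_apply, fanoutFn_apply, LpW_apply hS, bW_apply, dropFn_boolPair,
      takeFn_boolPair]; simp [ones]
  · rw [U1S, Function.comp_apply, fanoutFn_apply, key1W_apply hS hlp, Function.comp_apply, fanoutFn_apply, Function.comp_apply, fanoutFn_apply,
      LpW_apply hS, uLW_apply hS hlp, concatFn_boolPair, Com.ones_append, bW_apply, dropFn_boolPair, takeFn_boolPair]; simp [ones]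
  · rw [U3S, Function.comp_apply, fanoutFn_apply, key3W_apply hS hlp, Function.comp_apply, fanoutFn_apply, h3, bW_apply, dropFn_boolPair,
      takeFn_boolPair]; simp [ones]
  · rw [restS, Function.comp_apply, fanoutFn_apply, hc, bW_apply, dropFn_boolPair]; simp [ones]

/-- The record is the sampler record. [folklore] -/
theorem recS_apply : recS f kcP mlenF (winp N a s) =
    srec N (tOfA N a) [] false [] (s.take (P.Lp N)) ((s.drop (P.Lp N)).take (P.uLen N (tOfA N a))) [] := by
  obtain ⟨h1, h2, -⟩ := seed_slices_apply hS hlp N a s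
  rw [recS]
  simp only [fanoutFn_apply, NW_apply, tW_apply hlp, h1, h2, srec, encT, List.map_nil, List.flatten_nil, unary_eq_ones]

set_option maxHeartbeats 800000 in
/-- **Value of the core program** on a long enough seed (`coreLen ≤ |s|`, `1 ≤ kc N`). [cite: HastadImpagliazzoLevinLuby1999, Construction 7.0.4] -/
theorem coreS_apply (hk : 1 ≤ P.kc N) (hs : P.coreLen N a ≤ s.length) :
    coreS f kcP mlenF (winp N a s) = P.coreOut f N a (s.take (P.coreLen N a)) := by
  obtain ⟨h1, h2, h3, h4, -⟩ := seed_slices_apply hS hlp N a s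
  set pcs := s.take (P.Lp N) with hpcs_def
  set U := (s.drop (P.Lp N)).take (P.uLen N (tOfA N a)) with hU_def
  set U1 := (s.drop (P.Lp N + P.uLen N (tOfA N a))).take (P.key1 N a) with hU1_def
  set U3 := (s.drop (P.Lp N + P.uLen N (tOfA N a) + P.key1 N a)).take (P.key3 N a) with hU3_def
  have hcl : P.coreLen N a = P.Lp N + P.uLen N (tOfA N a) + P.key1 N a + P.key3 N a := rfl
  have hpcs : pcs.length = P.Lp N := by rw [hpcs_def, List.length_take]; omega
  have hU : U.length = P.uLen N (tOfA N a) := by rw [hU_def, List.length_take, List.length_drop]; omega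
  have hU1 : U1.length = P.key1 N a := by rw [hU1_def, List.length_take, List.length_drop]; omega
  have hU3 : U3.length = P.key3 N a := by rw [hU3_def, List.length_take, List.length_drop]; omega
  have hseed : s.take (P.coreLen N a) = pcs ++ U ++ U1 ++ U3 := by
    rw [hcl, List.take_add, List.take_add, List.take_add]
  have hh1 : h1S f kcP mlenF (winp N a s) = hashStr (P.Lp N) (P.m1 N a) U1 pcs := by
    rw [h1S, Function.comp_apply, fanoutFn_apply, fanoutFn_apply, fanoutFn_apply, LpW_apply hS, m1W_apply hS hlp, h3, h1, AffineProg.hashFn_boolPair]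
  have hD : DsampleF f kcP mlenF (recS f kcP mlenF (winp N a s)) = P.Dsample f N (tOfA N a) [] false [] pcs U := by
    rw [recS_apply hS hlp, DsampleF_apply hS hlp hk (τ := []) (by simp) false (fun h => absurd h Bool.false_ne_true) (by rw [hpcs, Lp]) _ []]
  have hβ : betaS f kcP mlenF (winp N a s) = P.Dsample f N (tOfA N a) [] false [] pcs U ++ (hashStr (P.Lp N) (P.m1 N a) U1 pcs ++ U1 ++ U3) := by
    rw [betaS, Function.comp_apply, fanoutFn_apply, Function.comp_apply, hD, Function.comp_apply, fanoutFn_apply, Function.comp_apply, fanoutFn_apply,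
      hh1, h3, h4, concatFn_boolPair, concatFn_boolPair, concatFn_boolPair]
  have hlong : pubLen N ≤ (P.Dsample f N (tOfA N a) [] false [] pcs U ++ (hashStr (P.Lp N) (P.m1 N a) U1 pcs ++ U1 ++ U3)).length := by
    rw [List.length_append, length_Dsample hlp (τ := []) (by simp) (fun h => absurd h Bool.false_ne_true) (by rw [hpcs, Lp]) hU, sLen]
    have : pubLen N ≤ P.kk N * pubLen N := Nat.le_mul_of_pos_left _ (Nat.one_le_pow _ _ hk)
    omega
  rw [coreS, Function.comp_apply, fanoutFn_apply, fanoutFn_apply, NW_apply, aW_apply, hβ, ← unary_eq_ones, show boolPair (unaryEncodeNat N)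
    (boolPair (ones a) (P.Dsample f N (tOfA N a) [] false [] pcs U ++ (hashStr (P.Lp N) (P.m1 N a) U1 pcs ++ U1 ++ U3))) =
    winp N a (P.Dsample f N (tOfA N a) [] false [] pcs U ++ (hashStr (P.Lp N) (P.m1 N a) U1 pcs ++ U1 ++ U3)) from rfl,
    phiF_apply hS hlp N a _ hlong, phiStr_Dsample_gen hlp N a hpcs hU (length_hashStr _ _ _ _) hU1, hseed, coreOut_append P f N a hpcs hU hU1, m2]

/-- **Value of the generator program** on a long enough seed. [cite: HastadImpagliazzoLevinLuby1999, Construction 7.0.4 with Prop. 4.8.1] -/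
theorem genF_apply (hk : 1 ≤ P.kc N) (hs : P.coreLen N a ≤ s.length) :
    genF f kcP mlenF dP (winp N a s) = takePad (dP.eval N + 1) (P.coreOut f N a (s.take (P.coreLen N a)) ++ s.drop (P.coreLen N a)) := by
  obtain ⟨-, -, -, -, h5⟩ := seed_slices_apply hS hlp N a s
  have hL : polyFn (dP + 1) (NW (winp N a s)) = ones (dP.eval N + 1) := by
    rw [NW_apply, polyFn_apply]; simp [ones]
  rw [genF, Function.comp_apply, fanoutFn_apply, Function.comp_apply, hL, Function.comp_apply, fanoutFn_apply, Function.comp_apply, fanoutFn_apply,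
    coreS_apply hS hlp N a s hk hs, h5, Function.comp_apply, Function.comp_apply, hL, Kannan.zerosFn_apply, concatFn_boolPair, concatFn_boolPair,
    takeFn_boolPair, takePad]
  simp [ones]

omit hS hlp in
/-- **The generator program always outputs `d(N)+1` bits.** [folklore] -/
theorem length_genF : (genF f kcP mlenF dP (winp N a s)).length = dP.eval N + 1 := by
  have hL : polyFn (dP + 1) (NW (winp N a s)) = ones (dP.eval N + 1) := by
    rw [NW_apply, polyFn_apply]; simp [ones]
  simp only [genF, Function.comp_apply, fanoutFn_apply, hL, Kannan.zerosFn_apply, concatFn_boolPair, takeFn_boolPair]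
  simp only [ones, List.length_replicate, List.length_take, List.length_append]
  omega

end GenValues

section GenMembership

variable (hS : ProgSpec P kcP mlenF) (hf : f ∈ FP)
include hS hf

set_option maxHeartbeats 800000 in
/-- **The generator program is in `FP`.** [cite: AroraBarak2009, §1.3] -/
theorem genF_mem_FP (dP : Polynomial ℕ) : genF f kcP mlenF dP ∈ FP := by
  obtain ⟨hphi, hm1, hLp, huL, hk1, ht, hN⟩ := phiF_mem_FP hS hf
  obtain ⟨-, -, hDs, -⟩ := samples_mem_FP hS hf
  have ha : aW ∈ FP := comp_mem_FP fstF_mem_FP sndF_mem_FP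
  have hb : bW ∈ FP := comp_mem_FP sndF_mem_FP sndF_mem_FP
  -- `key3W` again (not exported above): recompute its membership through `phiF`'s pieces is not possible; rebuild
  have hK : KW ∈ FP := comp_mem_FP logFn_mem_FP hN
  have h2N : twoN2W ∈ FP := comp_mem_FP (polyFn_mem_FP _) hN
  have hp2 : pow2bW ∈ FP := comp_mem_FP (cons_mem_FP true) (comp_mem_FP binToUnaryFn_mem_FP (fanoutFn_mem_FP h2N (comp_mem_FP (cons_mem_FP true) hK)))
  have hkk : kkW kcP ∈ FP := comp_mem_FP (polyFn_mem_FP _) hN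
  have hLg : LgW f ∈ FP := comp_mem_FP (LgU_mem_FP hf) (fanoutFn_mem_FP hN hN)
  have hfL : fLenW f kcP ∈ FP := comp_mem_FP HashBricks.umulFn_mem_FP (fanoutFn_mem_FP hkk hLg)
  have hEB : EBW f ∈ FP := comp_mem_FP HashBricks.umulFn_mem_FP (fanoutFn_mem_FP (comp_mem_FP HashBricks.umulFn_mem_FP
    (fanoutFn_mem_FP (const_mem_FP _) (comp_mem_FP (cons_mem_FP true) hLg))) hp2)
  have he : eW f ∈ FP := comp_mem_FP sndF_mem_FP (comp_mem_FP divModFn_mem_FP (fanoutFn_mem_FP hEB ha))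
  have hsl : slackW kcP ∈ FP := comp_mem_FP fstF_mem_FP (comp_mem_FP divModFn_mem_FP (fanoutFn_mem_FP
    (comp_mem_FP HashBricks.umulFn_mem_FP (fanoutFn_mem_FP (const_mem_FP _) hp2)) hkk))
  have hm3 : m3W f kcP ∈ FP := comp_mem_FP dropFn_mem_FP (fanoutFn_mem_FP h2N (comp_mem_FP dropFn_mem_FP (fanoutFn_mem_FP hsl
    (comp_mem_FP fstF_mem_FP (comp_mem_FP divModFn_mem_FP (fanoutFn_mem_FP (comp_mem_FP HashBricks.umulFn_mem_FP (fanoutFn_mem_FP (const_mem_FP _) hp2))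
      (comp_mem_FP HashBricks.umulFn_mem_FP (fanoutFn_mem_FP (comp_mem_FP HashBricks.umulFn_mem_FP (fanoutFn_mem_FP hkk he)) hK))))))))
  have hk3 : key3W f kcP ∈ FP := comp_mem_FP HashBricks.umulFn_mem_FP (fanoutFn_mem_FP hm3 (comp_mem_FP (cons_mem_FP true) hfL))
  have hpcs : pcsS kcP ∈ FP := comp_mem_FP takeFn_mem_FP (fanoutFn_mem_FP hLp hb)
  have hU : US f kcP mlenF ∈ FP := comp_mem_FP takeFn_mem_FP (fanoutFn_mem_FP huL (comp_mem_FP dropFn_mem_FP (fanoutFn_mem_FP hLp hb)))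
  have hpre : pre3W f kcP mlenF ∈ FP := comp_mem_FP concatFn_mem_FP (fanoutFn_mem_FP (comp_mem_FP concatFn_mem_FP (fanoutFn_mem_FP hLp huL)) hk1)
  have hcl : coreLenW f kcP mlenF ∈ FP := comp_mem_FP concatFn_mem_FP (fanoutFn_mem_FP hpre hk3)
  have hU1 : U1S f kcP mlenF ∈ FP := comp_mem_FP takeFn_mem_FP (fanoutFn_mem_FP hk1 (comp_mem_FP dropFn_mem_FP (fanoutFn_mem_FP
    (comp_mem_FP concatFn_mem_FP (fanoutFn_mem_FP hLp huL)) hb)))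
  have hU3 : U3S f kcP mlenF ∈ FP := comp_mem_FP takeFn_mem_FP (fanoutFn_mem_FP hk3 (comp_mem_FP dropFn_mem_FP (fanoutFn_mem_FP hpre hb)))
  have hrest : restS f kcP mlenF ∈ FP := comp_mem_FP dropFn_mem_FP (fanoutFn_mem_FP hcl hb)
  have hrec : recS f kcP mlenF ∈ FP := fanoutFn_mem_FP (fanoutFn_mem_FP hN ht) (fanoutFn_mem_FP (const_mem_FP _) (fanoutFn_mem_FP
    (fanoutFn_mem_FP (const_mem_FP _) (const_mem_FP _)) (fanoutFn_mem_FP hpcs (fanoutFn_mem_FP hU (const_mem_FP _)))))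
  have hh1 : h1S f kcP mlenF ∈ FP := comp_mem_FP AffineProg.hashFn_mem_FP (fanoutFn_mem_FP (fanoutFn_mem_FP hLp hm1) (fanoutFn_mem_FP hU1 hpcs))
  have hβ : betaS f kcP mlenF ∈ FP := comp_mem_FP concatFn_mem_FP (fanoutFn_mem_FP (comp_mem_FP hDs hrec) (comp_mem_FP concatFn_mem_FP
    (fanoutFn_mem_FP (comp_mem_FP concatFn_mem_FP (fanoutFn_mem_FP hh1 hU1)) hU3)))
  have hcore : coreS f kcP mlenF ∈ FP := comp_mem_FP hphi (fanoutFn_mem_FP hN (fanoutFn_mem_FP ha hβ))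
  exact comp_mem_FP takeFn_mem_FP (fanoutFn_mem_FP (comp_mem_FP (polyFn_mem_FP _) hN) (comp_mem_FP concatFn_mem_FP (fanoutFn_mem_FP
    (comp_mem_FP concatFn_mem_FP (fanoutFn_mem_FP hcore hrest)) (comp_mem_FP Kannan.zerosFn_mem_FP (comp_mem_FP (polyFn_mem_FP _) hN)))))

end GenMembership

end GenProg

end Params

end GH

end HILL

end Literature.Computability.Cryptography

/-!
## Part II — Pseudorandom generators from one-way functions (Håstad–Impagliazzo–Levin–Luby 1999, Theorems 7.0.5, 6.2.2)

> **Theorem 7.0.5** If `f` is a one-way function [and `ẽₙ`, `p̃ₙ` are within `1/n` of `eₙ`, `pₙ`] then `g` [of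
> Construction 7.0.4] is a mildly non-uniform pseudorandom generator. … **Theorem 6.2.2** There are one-way
> functions iff there are pseudorandom generators — here via §7: combined with Proposition 4.8.1 [mildly
> non-uniform ⇒ uniform], there is a pseudorandom generator if there is a one-way function.
> [HILL 1999, §7 p. 38–39, §6.2, §4.8]

Part II fixes the parameters (`kc(N) = 120N³ + 16N + 16`, `m₂ = K(⌊k t/2^b⌋ − kc²) − 2N − 2` with its `FP`
program, the advice `a*(N) = t*(N)·EB(N) + e*(N)`, `e*(N) = ⌊eₙ·2^{b+2}/K⌋`), proves the arithmetic of the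
exponents of the two statistical steps and of the stretch (`outLen = coreLen + surplus`, `surplus ≥ 1`), assembles
`H₀ ≈ H₁ ≈ H₂ ≈ H₃` (`HILLGenerator.lean`) into the pseudorandomness of the correct-advice candidate, pads/truncates to the
polynomial seed length, and concludes with `PRGExist_of_advice_levels` (HILL Prop. 4.8.1 with Prop. 3.3.4):
`PRGExist_of_isOneWay_lengthPreserving`. No new named facts.
-/

namespace Literature.Computability.Cryptography

open Finset Filter _root_.Computability Complexity Complexity.Brick Complexity.Plumb Complexity.OracleCompose Polynomial Real AffineStr
  HCProd PRGTrunc Asymptotics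

namespace HILL

namespace GH

/-! ### The parameters -/

/-- `kc(N) = 120N³ + 16N + 16` (`kc ≥ N`, `kc ≥ 8·2^b`, `k = kc³ ≥ (N+1)·128·cP²·4^b`). [cite: HastadImpagliazzoLevinLuby1999, §6.2 eq. (4) (kₙ, "a large polynomial")] -/
noncomputable def kcP₀ : Polynomial ℕ := 120 * X ^ 3 + 16 * X + 16

/-- `m₂(N, t) = K·⌊k t / 2^b⌋ − K·kc² − (2N + 2)` (HILL's `m'ₙ = kₙp̃ₙ − 2kₙ^{2/3}` with `K` GL bits per position). [cite: HastadImpagliazzoLevinLuby1999, §6.2 eq. (6)–(7), Constr. 7.0.4 (m'ₙ)] -/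
noncomputable def mlen₀ (N t : ℕ) : ℕ := kL N * (kcP₀.eval N ^ 3 * t / 2 ^ bLen N) - kL N * kcP₀.eval N ^ 2 - (2 * N + 2)

/-- **The parameters of the construction.** [cite: HastadImpagliazzoLevinLuby1999, §6.2 eq. (4)–(7)] -/
noncomputable def P₀ : Params := ⟨fun N => kcP₀.eval N, mlen₀⟩

/-- The bound `m₂ ≤ N·k·(2N+2)`. [folklore] -/
noncomputable def mB₀ : Polynomial ℕ := X * kcP₀ ^ 3 * (2 * X + 2)

namespace MlenProg

/-- `1^{2^b}` from `⟨1^N, 1^t⟩`. [folklore] -/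
noncomputable def pow2b : List Bool → List Bool :=
  List.cons true ∘ binToUnaryFn ∘ fanoutFn (polyFn (2 * X + 2) ∘ fstF) (List.cons true ∘ logFn ∘ fstF)

/-- **The program of `m₂`** on `⟨1^N, 1^t⟩`. [folklore] -/
noncomputable def mlenF₀ : List Bool → List Bool :=
  dropFn ∘ fanoutFn (polyFn (2 * X + 2) ∘ fstF)
    (dropFn ∘ fanoutFn (HashBricks.umulFn ∘ fanoutFn (logFn ∘ fstF) (polyFn (kcP₀ ^ 2) ∘ fstF))
      (HashBricks.umulFn ∘ fanoutFn (logFn ∘ fstF) (fstF ∘ divModFn ∘ fanoutFn pow2b (HashBricks.umulFn ∘ fanoutFn (polyFn (kcP₀ ^ 3) ∘ fstF) sndF))))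

/-- `|1ⁿ| = n`. [folklore] -/
private theorem length_unary (n : ℕ) : (unaryEncodeNat n).length = n := unary_decode_encode_nat n

/-- Value of `pow2b`. [folklore] -/
theorem pow2b_apply (N t : ℕ) : pow2b (boolPair (unaryEncodeNat N) (unaryEncodeNat t)) = ones (2 ^ bLen N) := by
  rw [pow2b, Function.comp_apply, Function.comp_apply, fanoutFn_apply, Function.comp_apply, fstF_boolPair, polyFn_apply, length_unary,
    Function.comp_apply, Function.comp_apply, fstF_boolPair, logFn, length_unary,
    show true :: ones (Nat.log 2 N) = ones (Nat.log 2 N + 1) by simp [ones, List.replicate_succ]]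
  simp only [eval_add, eval_mul, eval_ofNat, eval_X]
  rw [binToUnaryFn_boolPair, bitsToNat_ones]
  have h1 : 2 ^ (Nat.log 2 N + 1) - 1 ≤ (ones (2 * N + 2)).length := by
    simp only [ones, List.length_replicate]; have := two_pow_bLen_le N; rw [bLen] at this; omega
  rw [Nat.min_eq_left h1, bLen]
  have : 1 ≤ 2 ^ (Nat.log 2 N + 1) := Nat.one_le_two_pow
  simp only [ones]
  rw [← List.replicate_succ, Nat.sub_add_cancel this]

/-- **Value of `mlenF₀`.** [folklore] -/
theorem mlenF₀_apply (N t : ℕ) : mlenF₀ (boolPair (unaryEncodeNat N) (unaryEncodeNat t)) = ones (mlen₀ N t) := by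
  rw [mlenF₀]
  simp only [Function.comp_apply, fanoutFn_apply, fstF_boolPair, sndF_boolPair, pow2b_apply, polyFn_apply, length_unary, logFn,
    HashBricks.umulFn_boolPair, dropFn_boolPair]
  have hu : unaryEncodeNat t = ones t := by simp [ones, Complexity.unaryEncodeNat_eq_replicate]
  rw [hu, HashBricks.umulFn_boolPair, divModFn_boolPair, fstF_boolPair, HashBricks.umulFn_boolPair]
  simp only [ones, List.length_replicate, List.drop_replicate, mlen₀, kL, eval_add, eval_mul, eval_pow, eval_ofNat, eval_X]

/-- `mlenF₀ ∈ FP`. [cite: AroraBarak2009, §1.3] -/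
theorem mlenF₀_mem_FP : mlenF₀ ∈ FP := by
  have hp2 : pow2b ∈ FP := comp_mem_FP (cons_mem_FP true) (comp_mem_FP binToUnaryFn_mem_FP (fanoutFn_mem_FP
    (comp_mem_FP (polyFn_mem_FP _) fstF_mem_FP) (comp_mem_FP (cons_mem_FP true) (comp_mem_FP logFn_mem_FP fstF_mem_FP))))
  exact comp_mem_FP dropFn_mem_FP (fanoutFn_mem_FP (comp_mem_FP (polyFn_mem_FP _) fstF_mem_FP) (comp_mem_FP dropFn_mem_FP (fanoutFn_mem_FP
    (comp_mem_FP HashBricks.umulFn_mem_FP (fanoutFn_mem_FP (comp_mem_FP logFn_mem_FP fstF_mem_FP) (comp_mem_FP (polyFn_mem_FP _) fstF_mem_FP)))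
    (comp_mem_FP HashBricks.umulFn_mem_FP (fanoutFn_mem_FP (comp_mem_FP logFn_mem_FP fstF_mem_FP) (comp_mem_FP fstF_mem_FP (comp_mem_FP divModFn_mem_FP
      (fanoutFn_mem_FP hp2 (comp_mem_FP HashBricks.umulFn_mem_FP (fanoutFn_mem_FP (comp_mem_FP (polyFn_mem_FP _) fstF_mem_FP) sndF_mem_FP))))))))))

end MlenProg

/-- **The parameters are programmable.** [folklore] -/
theorem progSpec₀ : Params.ProgSpec P₀ kcP₀ MlenProg.mlenF₀ where
  kc_eq := fun _ => rfl
  mlenF_apply := MlenProg.mlenF₀_apply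
  mlenF_mem := MlenProg.mlenF₀_mem_FP

/-- `kc(N)` unfolded. [folklore] -/
theorem kc₀_eq (N : ℕ) : P₀.kc N = 120 * N ^ 3 + 16 * N + 16 := by
  show kcP₀.eval N = _; simp [kcP₀]

/-- `N ≤ kc(N)`. [folklore] -/
theorem le_kc₀ (N : ℕ) : N ≤ P₀.kc N := by rw [kc₀_eq]; have : N ≤ N ^ 3 := Nat.le_self_pow (by norm_num) N; omega

/-- `8·2^b ≤ kc(N)` and `1 ≤ kc(N)`. [folklore] -/
theorem eight_pow_le_kc₀ (N : ℕ) : 8 * 2 ^ bLen N ≤ P₀.kc N := by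
  rw [kc₀_eq]; have := two_pow_bLen_le N; omega

/-- `1 ≤ kc(N)`. [folklore] -/
theorem one_le_kc₀ (N : ℕ) : 1 ≤ P₀.kc N := by rw [kc₀_eq]; omega

/-- `m₂ ≤ mB₀`. [folklore] -/
theorem mlen₀_le (N t : ℕ) (ht : t ≤ 2 ^ bLen N) : P₀.mlen N t ≤ mB₀.eval N := by
  show mlen₀ N t ≤ _
  have hK := kL_le N
  have hb := two_pow_bLen_le N
  unfold mlen₀
  refine (Nat.sub_le _ _).trans ((Nat.sub_le _ _).trans ?_)
  have h1 : kcP₀.eval N ^ 3 * t / 2 ^ bLen N ≤ kcP₀.eval N ^ 3 * (2 * N + 2) :=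
    (Nat.div_le_self _ _).trans (Nat.mul_le_mul_left _ (ht.trans hb))
  calc kL N * (kcP₀.eval N ^ 3 * t / 2 ^ bLen N) ≤ N * (kcP₀.eval N ^ 3 * (2 * N + 2)) := Nat.mul_le_mul hK h1
    _ = mB₀.eval N := by simp [mB₀]; ring

/-! ### `𝒟 ≈_c ℰ` for the parameters (Lemmas 6.3.2 and 6.1.1) -/

/-- A Nat difference plus the subtrahend is at most the max. [folklore] -/
private theorem sub_add_le_max (x z : ℕ) : x - z + z ≤ max x z := by omega

/-- **`Hm`**: `m₂ + 2N + 2 ≤ K(k t*/2^b − kc²)` for all `N ≥ 2`. [cite: HastadImpagliazzoLevinLuby1999, §6.2 eq. (6)–(7)] -/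
theorem Hm₀ (f : List Bool → List Bool) :
    ∀ᶠ N : ℕ in atTop, (P₀.mlen N (tStar f N) : ℝ) + 2 * N + 2 ≤ kL N * (P₀.kk N * tStar f N / 2 ^ bLen N - (P₀.kc N : ℝ) ^ 2) := by
  refine Filter.eventually_atTop.2 ⟨2, fun N hN => ?_⟩
  have hK1 : 1 ≤ kL N := by
    unfold kL; exact Nat.succ_le_of_lt (Nat.log_pos one_lt_two hN)
  have ht1 := one_le_tStar f N
  have hQ := two_pow_bLen_le N
  have hkc := eight_pow_le_kc₀ N
  set kc := P₀.kc N with hkc_def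
  have hkk : P₀.kk N = kc ^ 3 := rfl
  set Q := 2 ^ bLen N with hQ_def
  have hQpos : 0 < Q := Nat.two_pow_pos _
  set q := kc ^ 3 * tStar f N / Q with hq
  have hmlen : P₀.mlen N (tStar f N) = kL N * q - kL N * kc ^ 2 - (2 * N + 2) := rfl
  -- real lower bound of the right-hand side
  have hQr : (0 : ℝ) < Q := by exact_mod_cast hQpos
  have hkcr : (8 : ℝ) * Q ≤ kc := by exact_mod_cast hkc
  have hqr : (q : ℝ) ≤ (kc : ℝ) ^ 3 * tStar f N / Q := by
    rw [le_div_iff₀ hQr]; exact_mod_cast Nat.div_mul_le_self (kc ^ 3 * tStar f N) Q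
  have hbig : (kc : ℝ) ^ 2 + (2 * N + 2) ≤ (kc : ℝ) ^ 3 * tStar f N / Q := by
    rw [le_div_iff₀ hQr]
    have h1 : (1 : ℝ) ≤ tStar f N := by exact_mod_cast ht1
    have hQ' : (Q : ℝ) ≤ 2 * N + 2 := by exact_mod_cast hQ
    have hQN : (N : ℝ) + 1 ≤ Q := by exact_mod_cast lt_two_pow_bLen N
    have hkc1 : (2 * N + 2 : ℝ) ≤ kc := by nlinarith
    have hkc0 : (0 : ℝ) ≤ kc := Nat.cast_nonneg _
    nlinarith [mul_le_mul_of_nonneg_left h1 (by positivity : (0 : ℝ) ≤ (kc : ℝ) ^ 3), sq_nonneg (kc : ℝ), mul_nonneg hkc0 hQr.le]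
  have hQeq : ((2 : ℝ) ^ bLen N) = (Q : ℝ) := by rw [hQ_def]; push_cast; ring
  have hK0 : (0 : ℝ) ≤ kL N := Nat.cast_nonneg _
  have hK1r : (1 : ℝ) ≤ kL N := by exact_mod_cast hK1
  have hdiff : (kc : ℝ) ^ 2 + (2 * N + 2) ≤ (kc : ℝ) ^ 3 * tStar f N / Q - 0 := by linarith
  have hrhs : ((max (kL N * q - kL N * kc ^ 2) (2 * N + 2) : ℕ) : ℝ) ≤ kL N * (P₀.kk N * tStar f N / 2 ^ bLen N - (kc : ℝ) ^ 2) := by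
    rw [hkk, hQeq]
    rcases le_total (kL N * q - kL N * kc ^ 2) (2 * N + 2) with h | h
    · rw [max_eq_right h]; push_cast
      nlinarith [mul_le_mul_of_nonneg_left hbig hK0, hbig]
    · rw [max_eq_left h]
      rcases le_total (kL N * kc ^ 2) (kL N * q) with h2 | h2
      · rw [Nat.cast_sub h2]; push_cast
        nlinarith [mul_le_mul_of_nonneg_left hqr hK0]
      · rw [Nat.sub_eq_zero_of_le h2]; push_cast
        nlinarith [mul_le_mul_of_nonneg_left hbig hK0, mul_nonneg hK0 (sq_nonneg (kc : ℝ))]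
  have hnat : P₀.mlen N (tStar f N) + (2 * N + 2) ≤ max (kL N * q - kL N * kc ^ 2) (2 * N + 2) := by
    rw [hmlen]; exact sub_add_le_max _ _
  have hnat' : (P₀.mlen N (tStar f N) : ℝ) + 2 * N + 2 ≤ ((max (kL N * q - kL N * kc ^ 2) (2 * N + 2) : ℕ) : ℝ) := by exact_mod_cast (by omega : P₀.mlen N (tStar f N) + 2 * N + 2 ≤ max (kL N * q - kL N * kc ^ 2) (2 * N + 2))
  exact hnat'.trans hrhs

/-- **`𝒟 ≈_c ℰ`** for the construction's parameters. [cite: HastadImpagliazzoLevinLuby1999, Lemma 6.3.2 with Lemma 6.1.1] -/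
theorem isCompIndistinguishable_DE₀ {f : List Bool → List Bool} (hf : IsOneWay f) (hlp : IsLengthPreserving f) :
    IsCompIndistinguishable (P₀.Dens f) (P₀.Eens f) :=
  Params.isCompIndistinguishable_DE (mB := mB₀) hf hlp progSpec₀ le_kc₀ (fun N => mlen₀_le N _ (tStar_le f N)) (Hm₀ f)

/-! ### The advice -/

/-- The entropy index `e*(N) = ⌊eₙ·2^{b+2}/K⌋` (clamped below `EB`). [cite: HastadImpagliazzoLevinLuby1999, Thm 7.0.5 (ẽₙ within 1/n of eₙ)] -/
noncomputable def eStar (f : List Bool → List Bool) (N : ℕ) : ℕ := min (Params.EB N - 1) ⌊Params.entN f N * 2 ^ (bLen N + 2) / kL N⌋₊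

/-- **The advice** `a*(N) = t*(N)·EB(N) + e*(N)`. [cite: HastadImpagliazzoLevinLuby1999, §7 ("there are O(n³) possible pairs of values to consider")] -/
noncomputable def aStar (f : List Bool → List Bool) (N : ℕ) : ℕ := tStar f N * Params.EB N + eStar f N

/-- `EB(N) ≥ 8`. [folklore] -/
theorem eight_le_EB (N : ℕ) : 8 ≤ Params.EB N := by
  unfold Params.EB; have : 1 ≤ 2 ^ bLen N := Nat.one_le_two_pow; nlinarith

/-- `e* < EB`. [folklore] -/
theorem eStar_lt (f : List Bool → List Bool) (N : ℕ) : eStar f N < Params.EB N := by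
  unfold eStar; have := eight_le_EB N; omega

/-- The density part of `a*` is `t*`. [folklore] -/
theorem tOfA_aStar (f : List Bool → List Bool) (N : ℕ) : Params.tOfA N (aStar f N) = tStar f N := by
  unfold Params.tOfA aStar
  rw [Nat.add_comm, Nat.add_mul_div_right _ _ (by have := eight_le_EB N; omega), Nat.div_eq_of_lt (eStar_lt f N), zero_add]

/-- The entropy part of `a*` is `e*`. [folklore] -/
theorem eOfA_aStar (f : List Bool → List Bool) (N : ℕ) : Params.eOfA N (aStar f N) = eStar f N := by
  unfold Params.eOfA aStar
  rw [Nat.add_comm, Nat.add_mul_mod_self_right, Nat.mod_eq_of_lt (eStar_lt f N)]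

/-- `Lg N ≤ 5N + 7 + rlen N`. [folklore] -/
theorem Lg_le (N : ℕ) : Lg N ≤ 5 * N + 7 + rlen N := by
  have h1 := nLen_le N; have h2 := hLen_le N; have h3 := ibLen_le_bLen N
  have h4 : bLen N ≤ N + 1 := by unfold bLen; have := Nat.log_le_self 2 N; omega
  unfold Lg; omega

/-- The polynomial bound on the advice. [folklore] -/
noncomputable def qA : Polynomial ℕ := (2 * X + 3) * (8 * (5 * X + 8 + R0) * (2 * X + 2))

/-- `a* ≤ qA`. [folklore] -/
theorem aStar_le (f : List Bool → List Bool) (N : ℕ) : aStar f N ≤ qA.eval N := by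
  have ht := (tStar_le f N).trans (two_pow_bLen_le N)
  have hE : Params.EB N ≤ 8 * (5 * N + 8 + rlen N) * (2 * N + 2) := by
    unfold Params.EB
    have := Lg_le N; have := two_pow_bLen_le N
    exact Nat.mul_le_mul (Nat.mul_le_mul_left _ (by omega)) ‹2 ^ bLen N ≤ 2 * N + 2›
  have he := (eStar_lt f N).le
  unfold aStar
  calc tStar f N * Params.EB N + eStar f N ≤ (2 * N + 2) * Params.EB N + Params.EB N := Nat.add_le_add (Nat.mul_le_mul_right _ ht) he
    _ = (2 * N + 3) * Params.EB N := by ring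
    _ ≤ (2 * N + 3) * (8 * (5 * N + 8 + rlen N) * (2 * N + 2)) := Nat.mul_le_mul_left _ hE
    _ = qA.eval N := by simp [qA, R0_eval]

/-! ### Bounds on the entropy `eₙ` of `f'` -/

namespace Params

/-- Entropy is at most `log₂` of the sample space. [folklore] -/
theorem mapEntropy_le_logb_card {ι β : Type*} [DecidableEq β] (S : Finset ι) (h : ι → β) : mapEntropy S h ≤ Real.logb 2 S.card := by
  classical
  rcases S.eq_empty_or_nonempty with rfl | hS
  · simp [mapEntropy]
  · unfold mapEntropy
    have hSpos : (0 : ℝ) < S.card := by exact_mod_cast hS.card_pos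
    rw [div_le_iff₀ hSpos]
    calc ∑ v ∈ S, Real.logb 2 ((S.card : ℝ) / (fiber S h (h v)).card) ≤ ∑ v ∈ S, Real.logb 2 S.card :=
          Finset.sum_le_sum fun v hv => logb_card_div_card_fiber_le h hv
      _ = Real.logb 2 S.card * S.card := by rw [Finset.sum_const, nsmul_eq_mul, mul_comm]

/-- `eₙ ≤ N + rlen N`. [folklore] -/
theorem entN_le (f : List Bool → List Bool) (N : ℕ) : entN f N ≤ N + rlen N := by
  refine (mapEntropy_le_logb_card _ _).trans (le_of_eq ?_)
  rw [Finset.card_univ, Fintype.card_prod, card_vector, card_vector, Fintype.card_bool, ← pow_add]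
  push_cast
  rw [Real.logb_pow, Real.logb_self_eq_one one_lt_two, mul_one]
  push_cast; ring

/-- `eₙ ≤ Lg N` for length-preserving `f` (the values are `Lg`-bit strings). [folklore] -/
theorem entN_le_Lg {f : List Bool → List Bool} (hlp : IsLengthPreserving f) (N : ℕ) : entN f N ≤ Lg N := by
  classical
  refine (Ent.mapEntropy_le_logb_card_image Finset.univ_nonempty _).trans ?_
  have hc : ((Finset.univ : Finset (WR N)).image (Ent.fvalV f N)).card ≤ 2 ^ Lg N :=
    card_le_two_pow_of_length_eq fun s hs => by
      obtain ⟨q, -, rfl⟩ := Finset.mem_image.1 hs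
      exact length_g hlp q.1.toList_length q.2.toList_length
  have hpos : 0 < ((Finset.univ : Finset (WR N)).image (Ent.fvalV f N)).card :=
    Finset.card_pos.2 ⟨_, Finset.mem_image_of_mem _ (Finset.mem_univ (Classical.arbitrary (WR N)))⟩
  calc Real.logb 2 (((Finset.univ : Finset (WR N)).image (Ent.fvalV f N)).card : ℝ) ≤ Real.logb 2 ((2 : ℝ) ^ Lg N) :=
        Real.logb_le_logb_of_le one_lt_two (by exact_mod_cast hpos) (by exact_mod_cast hc)
    _ = Lg N := by rw [Real.logb_pow, Real.logb_self_eq_one one_lt_two, mul_one]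

/-- `f'(w, r)` ends with `r`: dropping the first `nLen + hLen + ibLen` bits recovers `r`. [folklore] -/
theorem drop_fvalV {f : List Bool → List Bool} (hlp : IsLengthPreserving f) {N : ℕ} (q : WR N) :
    (Ent.fvalV f N q).drop (nLen N + hLen N + ibLen N) = q.2.toList := by
  have hw := q.1.toList_length
  have hx : (xOf q.1.toList).length = nLen N := by rw [length_xOf, hw]
  show (g f (q.1.toList ++ q.2.toList)).drop (nLen N + hLen N + ibLen N) = q.2.toList
  rw [g_append hw q.2.toList_length, body]
  have hl : (f (xOf q.1.toList) ++ maskTo N (icap N (iBits q.1.toList)) (hashStr (nLen N) (hLen N) q.2.toList (xOf q.1.toList)) ++ iBits q.1.toList).length =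
      nLen N + hLen N + ibLen N := by
    rw [List.length_append, List.length_append, hlp, hx, length_maskTo (length_hashStr _ _ _ _), length_iBits, hw]
  rw [List.drop_append_of_le_length hl.ge, List.drop_of_length_le hl.le, List.nil_append]

/-- `rlen N ≤ eₙ`: `f'` reveals its `r`. [cite: HastadImpagliazzoLevinLuby1999, §6.1 eq. (3) (r is part of the output of f')] -/
theorem rlen_le_entN {f : List Bool → List Bool} (hlp : IsLengthPreserving f) (N : ℕ) : (rlen N : ℝ) ≤ entN f N := by
  classical
  have h1 : mapEntropy (Finset.univ : Finset (WR N)) ((fun v : List Bool => v.drop (nLen N + hLen N + ibLen N)) ∘ Ent.fvalV f N) ≤ entN f N :=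
    mapEntropy_comp_le _ _ _
  have h2 : mapEntropy (Finset.univ : Finset (WR N)) ((fun v : List Bool => v.drop (nLen N + hLen N + ibLen N)) ∘ Ent.fvalV f N) =
      mapEntropy (Finset.univ : Finset (WR N)) (fun q : WR N => ((), q.2)) := by
    refine mapEntropy_eq_of_ker_eq fun v w => ?_
    rw [Function.comp_apply, Function.comp_apply, drop_fvalV hlp, drop_fvalV hlp, Prod.mk.injEq]
    exact ⟨fun h => ⟨rfl, List.Vector.toList_injective h⟩, fun h => by rw [h.2]⟩
  have h3 : mapEntropy (Finset.univ : Finset (WR N)) (fun q : WR N => ((), q.2)) = rlen N := by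
    have hp := mapEntropy_prod_pair (fun _ : List.Vector Bool N => ()) (fun r : List.Vector Bool (rlen N) => r)
    rw [mapEntropy_const', Ent.mapEntropy_of_injective (fun a b h => h), card_vector, Fintype.card_bool, zero_add] at hp
    rw [show (fun q : WR N => ((), q.2)) = fun q : WR N => ((fun _ : List.Vector Bool N => ()) q.1, (fun r : List.Vector Bool (rlen N) => r) q.2) from rfl, hp]
    push_cast
    rw [Real.logb_pow, Real.logb_self_eq_one one_lt_two, mul_one]
  linarith

end Params

/-! ### The arithmetic of the lengths at the correct advice -/

section Arith

variable {f : List Bool → List Bool}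

/-- `K ≥ 1` for `N ≥ 2`. [folklore] -/
theorem one_le_K {N : ℕ} (hN : 2 ≤ N) : 1 ≤ kL N := Nat.succ_le_of_lt (Nat.log_pos one_lt_two hN)

/-- `K ≤ rlen N`. [folklore] -/
theorem K_le_rlen (N : ℕ) : kL N ≤ rlen N := (kL_le N).trans (by unfold rlen; nlinarith)

/-- **`e*` is the plain floor** (the clamp is inactive): `e* = ⌊eₙ 2^{b+2}/K⌋`. [folklore] -/
theorem eStar_eq (hlp : IsLengthPreserving f) {N : ℕ} (hN : 2 ≤ N) : eStar f N = ⌊Params.entN f N * 2 ^ (bLen N + 2) / kL N⌋₊ := by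
  unfold eStar
  refine min_eq_right (Nat.le_sub_one_of_lt ?_)
  have hK : (1 : ℝ) ≤ kL N := by exact_mod_cast one_le_K hN
  have hE := Params.entN_le_Lg hlp N
  have hE0 : 0 ≤ Params.entN f N := le_trans (by exact_mod_cast Nat.zero_le _) (Params.rlen_le_entN hlp N)
  rw [Nat.floor_lt (by positivity)]
  unfold Params.EB
  push_cast
  rw [div_lt_iff₀ (by positivity), pow_add]
  have hQ0 : (0 : ℝ) < (2 : ℝ) ^ bLen N := by positivity
  have hL0 : (0 : ℝ) ≤ Lg N := Nat.cast_nonneg _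
  calc Params.entN f N * ((2 : ℝ) ^ bLen N * 2 ^ 2) ≤ Lg N * ((2 : ℝ) ^ bLen N * 2 ^ 2) := mul_le_mul_of_nonneg_right hE (by positivity)
    _ < 8 * ((Lg N : ℝ) + 1) * 2 ^ bLen N * 1 := by nlinarith
    _ ≤ 8 * ((Lg N : ℝ) + 1) * 2 ^ bLen N * kL N := mul_le_mul_of_nonneg_left hK (by positivity)

/-- `e* ≤ eₙ 2^{b+2}/K`. [folklore] -/
theorem eStar_le_real (hlp : IsLengthPreserving f) {N : ℕ} (hN : 2 ≤ N) : (eStar f N : ℝ) ≤ Params.entN f N * 2 ^ (bLen N + 2) / kL N := by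
  rw [eStar_eq hlp hN]
  have hE0 : 0 ≤ Params.entN f N := le_trans (by exact_mod_cast Nat.zero_le _) (Params.rlen_le_entN hlp N)
  exact Nat.floor_le (by positivity)

/-- `eₙ 2^{b+2}/K − 1 < e*`. [folklore] -/
theorem lt_eStar_real (hlp : IsLengthPreserving f) {N : ℕ} (hN : 2 ≤ N) : Params.entN f N * 2 ^ (bLen N + 2) / kL N - 1 < eStar f N := by
  rw [eStar_eq hlp hN]; exact Nat.sub_one_lt_floor _

/-- `4·2^b ≤ e*` (`eₙ ≥ rlen ≥ K`). [folklore] -/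
theorem four_pow_le_eStar (hlp : IsLengthPreserving f) {N : ℕ} (hN : 2 ≤ N) : 4 * 2 ^ bLen N ≤ eStar f N := by
  have hK : (0 : ℝ) < kL N := by exact_mod_cast one_le_K hN
  have h1 := lt_eStar_real hlp hN
  have hE := Params.rlen_le_entN hlp N
  have hKr : (kL N : ℝ) ≤ rlen N := by exact_mod_cast K_le_rlen N
  have h2 : (4 * 2 ^ bLen N : ℝ) ≤ Params.entN f N * 2 ^ (bLen N + 2) / kL N := by
    rw [le_div_iff₀ hK, pow_add]; nlinarith [mul_le_mul_of_nonneg_right (hKr.trans hE) (by positivity : (0 : ℝ) ≤ 4 * 2 ^ bLen N)]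
  have h3 : ((4 * 2 ^ bLen N : ℕ) : ℝ) - 1 < eStar f N := by push_cast; linarith
  exact_mod_cast Nat.le_of_pred_lt (by exact_mod_cast (show ((4 * 2 ^ bLen N - 1 : ℕ) : ℝ) < eStar f N by
    rw [Nat.cast_sub (Nat.one_le_iff_ne_zero.2 (by positivity))]; exact_mod_cast h3))

/-- `e*·K ≤ 4·2^b·(N + rlen)` (`eₙ ≤ N + rlen`). [folklore] -/
theorem eStar_mul_K_le (hlp : IsLengthPreserving f) {N : ℕ} (hN : 2 ≤ N) : eStar f N * kL N ≤ 4 * 2 ^ bLen N * (N + rlen N) := by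
  have hK : (0 : ℝ) < kL N := by exact_mod_cast one_le_K hN
  have h1 := eStar_le_real hlp hN
  have hE := Params.entN_le f N
  have h2 : (eStar f N : ℝ) * kL N ≤ 4 * 2 ^ bLen N * (N + rlen N) := by
    rw [le_div_iff₀ hK, pow_add] at h1
    nlinarith [mul_le_mul_of_nonneg_right hE (by positivity : (0 : ℝ) ≤ 4 * 2 ^ bLen N)]
  exact_mod_cast h2

/-- `t*/2^b ≥ p₀ = #𝒯₀/2^N` and `t*/2^b < p₀ + 2^{−b}` in counting form (`N ≥ 1`). [folklore] -/
theorem tStar_sandwich (f : List Bool → List Bool) (N : ℕ) :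
    (T f 0 N).card ≤ tStar f N * 2 ^ nLen N ∧ tStar f N * 2 ^ nLen N < (T f 0 N).card + 2 ^ nLen N := by
  have h := tStar_spec f N
  have hnb : N - bLen N = nLen N := rfl
  rwa [hnb] at h

/-- `p₀ ≤ 1 − 2^{−b}` in counting form: `#𝒯₀ + 2ⁿ ≤ 2^N` (`N ≥ 2`). [folklore] -/
theorem card_T_zero_add_le_pow (f : List Bool → List Bool) {N : ℕ} (hN : 2 ≤ N) : (T f 0 N).card + 2 ^ nLen N ≤ 2 ^ N := by
  have h1 := card_T_zero_add_le f (by omega : 1 ≤ N)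
  have h2 := card_T_one_le f hN
  have h3 : 0 < 2 ^ nLen N := Nat.two_pow_pos _
  omega

variable (f)

/-- `16N + 16 ≤ kc ≤ k`, `slack·16 ≤ k`. [folklore] -/
theorem kc₀_facts (N : ℕ) : 16 * N + 16 ≤ P₀.kc N ∧ P₀.kc N ≤ P₀.kk N ∧ P₀.slack N * 16 ≤ P₀.kk N ∧ P₀.kk N = P₀.kc N ^ 3 := by
  have h1 : 16 * N + 16 ≤ P₀.kc N := by rw [kc₀_eq]; have := Nat.zero_le (120 * N ^ 3); linarith
  have h2 : P₀.kc N ≤ P₀.kk N := Nat.le_self_pow (by norm_num) _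
  have h3 : P₀.slack N * 16 ≤ P₀.kk N := by
    show P₀.kk N / (16 * 2 ^ bLen N) * 16 ≤ P₀.kk N
    calc P₀.kk N / (16 * 2 ^ bLen N) * 16 ≤ P₀.kk N / (16 * 2 ^ bLen N) * (16 * 2 ^ bLen N) :=
          Nat.mul_le_mul_left _ (by have : 1 ≤ 2 ^ bLen N := Nat.one_le_two_pow; nlinarith)
      _ ≤ P₀.kk N := Nat.div_mul_le_self _ _
  exact ⟨h1, h2, h3, rfl⟩

/-- **No truncation in `m₃`.** [folklore] -/
theorem m3_eq (hlp : IsLengthPreserving f) {N : ℕ} (hN : 2 ≤ N) :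
    P₀.m3 N (aStar f N) + P₀.slack N + (2 * N + 2) = P₀.kk N * eStar f N * kL N / 2 ^ (bLen N + 2) := by
  have hK := one_le_K hN
  have he := four_pow_le_eStar hlp hN
  obtain ⟨hkc16, hk1, hs, -⟩ := kc₀_facts N
  have hX : P₀.kk N ≤ P₀.kk N * eStar f N * kL N / 2 ^ (bLen N + 2) := by
    rw [Nat.le_div_iff_mul_le (by positivity), pow_add, mul_assoc]
    calc P₀.kk N * (2 ^ bLen N * 2 ^ 2) = P₀.kk N * (4 * 2 ^ bLen N) := by ring
      _ ≤ P₀.kk N * (eStar f N * kL N) := Nat.mul_le_mul_left _ (by nlinarith)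
  show P₀.kk N * (aStar f N % Params.EB N) * kL N / 2 ^ (bLen N + 2) - P₀.slack N - (2 * N + 2) + P₀.slack N + (2 * N + 2) = _
  rw [show aStar f N % Params.EB N = eStar f N from eOfA_aStar f N]
  omega

/-- **No truncation in `M13`.** [folklore] -/
theorem M13_eq {N : ℕ} (hN : 2 ≤ N) :
    P₀.M13 N (aStar f N) + P₀.kk N * kL N * tStar f N / 2 ^ bLen N + 2 * P₀.slack N + 2 * (2 * N + 2) + 3 =
      P₀.kk N * (N + rlen N + kL N) + P₀.kk N * kL N / 2 ^ (bLen N + 1) := by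
  have ht := tStar_le f N
  obtain ⟨hkc16, hk1, hs, -⟩ := kc₀_facts N
  have hC : P₀.kk N * kL N * tStar f N / 2 ^ bLen N ≤ P₀.kk N * kL N :=
    Nat.div_le_of_le_mul (by rw [mul_comm (2 ^ bLen N)]; exact Nat.mul_le_mul_left _ ht)
  have hA : P₀.kk N * (N + rlen N + kL N) = P₀.kk N * (N + rlen N) + P₀.kk N * kL N := by ring
  have hc0 : 6 * P₀.kk N ≤ P₀.kk N * (N + rlen N) := by rw [mul_comm]; exact Nat.mul_le_mul_left _ (by unfold rlen; nlinarith)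
  show P₀.kk N * (N + rlen N + kL N) + P₀.kk N * kL N / 2 ^ (bLen N + 1) - P₀.kk N * kL N * (aStar f N / Params.EB N) / 2 ^ bLen N -
      2 * P₀.slack N - 2 * (2 * N + 2) - 3 + P₀.kk N * kL N * tStar f N / 2 ^ bLen N + 2 * P₀.slack N + 2 * (2 * N + 2) + 3 = _
  rw [show aStar f N / Params.EB N = tStar f N from tOfA_aStar f N]
  have hle : P₀.kk N * kL N * tStar f N / 2 ^ bLen N + 2 * P₀.slack N + 2 * (2 * N + 2) + 3 ≤
      P₀.kk N * (N + rlen N + kL N) + P₀.kk N * kL N / 2 ^ (bLen N + 1) := by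
    rw [hA]; have := Nat.zero_le (P₀.kk N * kL N / 2 ^ (bLen N + 1)); linarith
  omega

/-- **No truncation in `m₁ = M13 − m₃`.** [folklore] -/
theorem m1_eq (hlp : IsLengthPreserving f) {N : ℕ} (hN : 2 ≤ N) : P₀.m1 N (aStar f N) + P₀.m3 N (aStar f N) = P₀.M13 N (aStar f N) := by
  have h3 := m3_eq f hlp hN
  have hM := M13_eq f hN
  have hK := one_le_K hN
  have ht := tStar_le f N
  have heK := eStar_mul_K_le hlp hN
  obtain ⟨hkc16, hk1, hs, hkk⟩ := kc₀_facts N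
  have hQ := two_pow_bLen_le N
  have hC : P₀.kk N * kL N * tStar f N / 2 ^ bLen N ≤ P₀.kk N * kL N :=
    Nat.div_le_of_le_mul (by rw [mul_comm (2 ^ bLen N)]; exact Nat.mul_le_mul_left _ ht)
  have hX : P₀.kk N * eStar f N * kL N / 2 ^ (bLen N + 2) ≤ P₀.kk N * (N + rlen N) := by
    refine Nat.div_le_of_le_mul ?_
    rw [mul_assoc, pow_add, show (2 : ℕ) ^ 2 = 4 by norm_num]
    calc P₀.kk N * (eStar f N * kL N) ≤ P₀.kk N * (4 * 2 ^ bLen N * (N + rlen N)) := Nat.mul_le_mul_left _ heK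
      _ = 2 ^ bLen N * 4 * (P₀.kk N * (N + rlen N)) := by ring
  have h8 : 8 * P₀.slack N ≤ P₀.kk N * kL N / 2 ^ (bLen N + 1) := by
    show 8 * (P₀.kk N / (16 * 2 ^ bLen N)) ≤ P₀.kk N * kL N / 2 ^ (bLen N + 1)
    rw [Nat.le_div_iff_mul_le (by positivity)]
    calc 8 * (P₀.kk N / (16 * 2 ^ bLen N)) * 2 ^ (bLen N + 1) = P₀.kk N / (16 * 2 ^ bLen N) * (16 * 2 ^ bLen N) := by rw [pow_succ]; ring
      _ ≤ P₀.kk N := Nat.div_mul_le_self _ _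
      _ ≤ P₀.kk N * kL N := Nat.le_mul_of_pos_right _ hK
  have hkc2 : 16 * (2 * N + 5) ≤ P₀.kc N ^ 2 := by
    calc 16 * (2 * N + 5) ≤ (16 * N + 16) * (16 * N + 16) := by nlinarith
      _ ≤ P₀.kc N * P₀.kc N := Nat.mul_le_mul hkc16 hkc16
      _ = P₀.kc N ^ 2 := (sq _).symm
  have hs2 : 2 * N + 5 ≤ P₀.slack N := by
    show 2 * N + 5 ≤ P₀.kk N / (16 * 2 ^ bLen N)
    rw [Nat.le_div_iff_mul_le (by positivity), hkk]
    calc (2 * N + 5) * (16 * 2 ^ bLen N) ≤ (2 * N + 5) * (16 * (2 * N + 2)) := Nat.mul_le_mul_left _ (Nat.mul_le_mul_left _ hQ)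
      _ = 16 * (2 * N + 5) * (2 * N + 2) := by ring
      _ ≤ P₀.kc N ^ 2 * P₀.kc N := Nat.mul_le_mul hkc2 (by omega)
      _ = P₀.kc N ^ 3 := by ring
  have hA : P₀.kk N * (N + rlen N + kL N) = P₀.kk N * (N + rlen N) + P₀.kk N * kL N := by ring
  have hle : P₀.m3 N (aStar f N) ≤ P₀.M13 N (aStar f N) := by omega
  show P₀.M13 N (aStar f N) - P₀.m3 N (aStar f N) + P₀.m3 N (aStar f N) = _
  omega

/-- **No truncation in `m₂`.** [folklore] -/
theorem m2_eq {N : ℕ} (hN : 2 ≤ N) :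
    P₀.m2 N (aStar f N) + kL N * P₀.kc N ^ 2 + (2 * N + 2) = kL N * (P₀.kk N * tStar f N / 2 ^ bLen N) := by
  have hK := one_le_K hN
  have ht1 := one_le_tStar f N
  have hkc := eight_pow_le_kc₀ N
  obtain ⟨hkc16, -, -, hkk⟩ := kc₀_facts N
  have hD : 8 * P₀.kc N ^ 2 ≤ P₀.kk N * tStar f N / 2 ^ bLen N := by
    rw [Nat.le_div_iff_mul_le (by positivity), hkk]
    calc 8 * P₀.kc N ^ 2 * 2 ^ bLen N = P₀.kc N ^ 2 * (8 * 2 ^ bLen N) := by ring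
      _ ≤ P₀.kc N ^ 2 * P₀.kc N := Nat.mul_le_mul_left _ hkc
      _ = P₀.kc N ^ 3 * 1 := by ring
      _ ≤ P₀.kc N ^ 3 * tStar f N := Nat.mul_le_mul_left _ ht1
  have hKD : 8 * (kL N * P₀.kc N ^ 2) ≤ kL N * (P₀.kk N * tStar f N / 2 ^ bLen N) := by
    calc 8 * (kL N * P₀.kc N ^ 2) = kL N * (8 * P₀.kc N ^ 2) := by ring
      _ ≤ _ := Nat.mul_le_mul_left _ hD
  have hkc2 : 2 * N + 2 ≤ P₀.kc N ^ 2 := by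
    calc 2 * N + 2 ≤ 16 * N + 16 := by omega
      _ ≤ P₀.kc N := hkc16
      _ ≤ P₀.kc N ^ 2 := Nat.le_self_pow (by norm_num) _
  have hKkc : P₀.kc N ^ 2 ≤ kL N * P₀.kc N ^ 2 := Nat.le_mul_of_pos_left _ hK
  show kL N * (P₀.kk N * (aStar f N / Params.EB N) / 2 ^ bLen N) - kL N * P₀.kc N ^ 2 - (2 * N + 2) + kL N * P₀.kc N ^ 2 + (2 * N + 2) = _
  rw [show aStar f N / Params.EB N = tStar f N from tOfA_aStar f N]
  omega

/-- **The flattening parameter** `η = 1/(16·cP·2^b)` (so that `kη·cP = k/(16·2^b)`). [cite: HastadImpagliazzoLevinLuby1999, §7 ("sacrifice 2nk^{2/3}")] -/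
noncomputable def ηN (N : ℕ) : ℝ := 1 / (16 * Params.cP N * 2 ^ bLen N)

/-- `kη cP = k/(16·2^b)`. [folklore] -/
theorem kk_mul_η_mul_cP (N : ℕ) : (P₀.kk N : ℝ) * ηN N * Params.cP N = P₀.kk N / (16 * 2 ^ bLen N) := by
  have hc1 : 1 ≤ Params.cP N := by unfold Params.cP rlen; nlinarith
  have hc : (0 : ℝ) < Params.cP N := by exact_mod_cast hc1
  unfold ηN; field_simp

/-- `Params.cP N ≤ 10 N²` (`N ≥ 2`). [folklore] -/
theorem cP_le {N : ℕ} (hN : 2 ≤ N) : Params.cP N ≤ 10 * N ^ 2 := by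
  have hK := kL_le N
  unfold Params.cP rlen
  nlinarith [Nat.mul_le_mul_right N hK]

/-- **The flattening exponent**: `N + 1 ≤ 2kη²`. [cite: HastadImpagliazzoLevinLuby1999, Cor. 4.5.3 (k^{1/3} ≥ n)] -/
theorem flat_bound {N : ℕ} (hN : 2 ≤ N) : (N : ℝ) + 1 ≤ 2 * P₀.kk N * ηN N ^ 2 := by
  have hc1 : 1 ≤ Params.cP N := by unfold Params.cP rlen; nlinarith
  have hc : (0 : ℝ) < Params.cP N := by exact_mod_cast hc1
  have hQ : (0 : ℝ) < (2 : ℝ) ^ bLen N := by positivity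
  -- in `ℕ`: `128 (N+1) cP² Q² ≤ k`
  have hcP := cP_le hN
  have hQle : 2 ^ bLen N ≤ 3 * N := (two_pow_bLen_le N).trans (by omega)
  obtain ⟨hkc16, -, -, hkk⟩ := kc₀_facts N
  have hkc : 120 * N ^ 3 ≤ P₀.kc N := by rw [kc₀_eq]; omega
  have hnat : 128 * (N + 1) * (Params.cP N) ^ 2 * (2 ^ bLen N) ^ 2 ≤ P₀.kk N := by
    have h1 : 128 * (N + 1) * (Params.cP N) ^ 2 * (2 ^ bLen N) ^ 2 ≤ 128 * (2 * N) * (10 * N ^ 2) ^ 2 * (3 * N) ^ 2 :=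
      Nat.mul_le_mul (Nat.mul_le_mul (Nat.mul_le_mul_left _ (by omega)) (Nat.pow_le_pow_left hcP 2)) (Nat.pow_le_pow_left hQle 2)
    have h2 : 128 * (2 * N) * (10 * N ^ 2) ^ 2 * (3 * N) ^ 2 = 230400 * N ^ 7 := by ring
    have h3 : 230400 * N ^ 7 ≤ (120 * N ^ 3) ^ 3 := by
      have : N ^ 7 ≤ N ^ 9 := Nat.pow_le_pow_right (by omega) (by norm_num)
      nlinarith
    calc _ ≤ 230400 * N ^ 7 := h1.trans h2.le
      _ ≤ (120 * N ^ 3) ^ 3 := h3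
      _ ≤ P₀.kc N ^ 3 := Nat.pow_le_pow_left hkc 3
      _ = P₀.kk N := hkk.symm
  have hr : (128 * (N + 1) * (Params.cP N : ℝ) ^ 2 * ((2 : ℝ) ^ bLen N) ^ 2) ≤ P₀.kk N := by exact_mod_cast hnat
  unfold ηN
  rw [div_pow, one_pow, mul_pow, mul_pow]
  rw [show (2 : ℝ) * P₀.kk N * (1 / ((16 : ℝ) ^ 2 * (Params.cP N : ℝ) ^ 2 * ((2 : ℝ) ^ bLen N) ^ 2)) = P₀.kk N / (128 * (Params.cP N : ℝ) ^ 2 * ((2 : ℝ) ^ bLen N) ^ 2) by ring]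
  rw [le_div_iff₀ (by positivity)]
  nlinarith

/-- `2e^{−2kη²} ≤ 1`. [folklore] -/
theorem hε₀ {N : ℕ} (hN : 2 ≤ N) : 2 * Real.exp (-2 * P₀.kk N * ηN N ^ 2) ≤ 1 := by
  have h := flat_bound hN
  have hN1 : (1 : ℝ) ≤ N := by exact_mod_cast (by omega : 1 ≤ N)
  have h2 : Real.exp (-2 * P₀.kk N * ηN N ^ 2) ≤ Real.exp (-1) := Real.exp_le_exp.2 (by nlinarith)
  have h3 : Real.exp (-1) ≤ 1 / 2 := by
    rw [Real.exp_neg, inv_eq_one_div, div_le_div_iff₀ (Real.exp_pos 1) (by norm_num), one_mul]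
    have := Real.add_one_le_exp (1 : ℝ); linarith
  linarith

/-- The statistical term `2e^{−2kη²} ≤ 2e^{−(N+1)}`. [folklore] -/
theorem flat_term_le {N : ℕ} (hN : 2 ≤ N) : 2 * Real.exp (-2 * P₀.kk N * ηN N ^ 2) ≤ 2 * Real.exp (-(N + 1 : ℝ)) := by
  have h := flat_bound hN
  nlinarith [Real.exp_le_exp.2 (show -2 * (P₀.kk N : ℝ) * ηN N ^ 2 ≤ -(N + 1 : ℝ) by nlinarith), Real.exp_pos (-2 * (P₀.kk N : ℝ) * ηN N ^ 2)]

/-- **The exponent of step (3)**: `m₃ + 2N + 1 ≤ k·eₙ − kη·cP`. [cite: HastadImpagliazzoLevinLuby1999, Thm 7.0.5 (proof, step (3): m''ₙ = kₙẽₙ − 2nkₙ^{2/3})] -/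
theorem exp3_bound (hlp : IsLengthPreserving f) {N : ℕ} (hN : 2 ≤ N) :
    (P₀.m3 N (aStar f N) : ℝ) + 2 * N + 1 ≤ P₀.kk N * Params.entN f N - P₀.kk N * ηN N * Params.cP N := by
  rw [kk_mul_η_mul_cP]
  have h3 := m3_eq f hlp hN
  have hK : (0 : ℝ) < kL N := by exact_mod_cast one_le_K hN
  have hQ : (0 : ℝ) < (2 : ℝ) ^ bLen N := by positivity
  have hk0 : (0 : ℝ) ≤ P₀.kk N := Nat.cast_nonneg _
  have he := eStar_le_real hlp hN
  -- `X ≤ k E`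
  have hX : ((P₀.kk N * eStar f N * kL N / 2 ^ (bLen N + 2) : ℕ) : ℝ) ≤ P₀.kk N * Params.entN f N := by
    refine (Nat.cast_div_le).trans ?_
    push_cast
    rw [div_le_iff₀ (by positivity), pow_add]
    rw [le_div_iff₀ hK, pow_add] at he
    nlinarith [mul_le_mul_of_nonneg_left he hk0]
  -- `slack ≥ k/(16Q) − 1`
  have hs : (P₀.kk N : ℝ) / (16 * 2 ^ bLen N) - 1 ≤ (P₀.slack N : ℝ) := by
    have h1 : P₀.kk N < (P₀.slack N + 1) * (16 * 2 ^ bLen N) := by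
      rw [Nat.succ_mul]; exact Nat.lt_div_mul_add (by positivity)
    have h2 : (P₀.kk N : ℝ) < ((P₀.slack N : ℝ) + 1) * (16 * 2 ^ bLen N) := by exact_mod_cast h1
    rw [sub_le_iff_le_add, div_le_iff₀ (by positivity)]; exact h2.le
  have hcast : (P₀.m3 N (aStar f N) : ℝ) + P₀.slack N + (2 * N + 2) = ((P₀.kk N * eStar f N * kL N / 2 ^ (bLen N + 2) : ℕ) : ℝ) := by
    exact_mod_cast h3
  linarith

/-- A Nat floor-division as a real lower bound: `x/y − 1 ≤ ⌊x/y⌋`. [folklore] -/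
private theorem div_sub_one_le_cast (x : ℕ) {y : ℕ} (hy : 0 < y) : (x : ℝ) / y - 1 ≤ ((x / y : ℕ) : ℝ) := by
  have h1 : x < (x / y + 1) * y := by rw [Nat.succ_mul]; exact Nat.lt_div_mul_add hy
  have h2 : (x : ℝ) < (((x / y : ℕ) : ℝ) + 1) * y := by exact_mod_cast h1
  have hy' : (0 : ℝ) < y := by exact_mod_cast hy
  rw [sub_le_iff_le_add, div_le_iff₀ hy']; exact h2.le

set_option maxHeartbeats 1600000 in
/-- **The exponent of step (1)**: `m₁ + 2N + 1 ≤ k·H(pc | f', σ, GL) − kη·cP`.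
[cite: HastadImpagliazzoLevinLuby1999, Thm 7.0.5 (proof, step (1): mₙ = kₙ(cₙ − ẽₙ − p̃ₙ + 1/2n) − 2nkₙ^{2/3})] -/
theorem exp1_bound (hlp : IsLengthPreserving f) {N : ℕ} (hN : 2 ≤ N) :
    (P₀.m1 N (aStar f N) : ℝ) + 2 * N + 1 ≤
      P₀.kk N * (mapEntropy (Finset.univ : Finset (Params.PC N)) (fun pc => (pc, Params.y1 f N pc)) -
        mapEntropy (Finset.univ : Finset (Params.PC N)) (Params.y1 f N)) - P₀.kk N * ηN N * Params.cP N := by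
  rw [kk_mul_η_mul_cP]
  -- notation
  set kk : ℝ := (P₀.kk N : ℝ) with hkkd
  set KK : ℝ := (kL N : ℝ) with hKKd
  set qQ : ℝ := (2 : ℝ) ^ bLen N with hqQd
  set tt : ℝ := (tStar f N : ℝ) with httd
  set E : ℝ := Params.entN f N with hEd
  set H1 : ℝ := mapEntropy (Finset.univ : Finset (Params.PC N)) (fun pc => (pc, Params.y1 f N pc)) -
    mapEntropy (Finset.univ : Finset (Params.PC N)) (Params.y1 f N) with hH1d
  have hkk0 : 0 ≤ kk := Nat.cast_nonneg _
  have hK1 : 1 ≤ KK := by rw [hKKd]; exact_mod_cast one_le_K hN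
  have hK0 : 0 < KK := by linarith
  have hQ1 : 1 ≤ qQ := by rw [hqQd]; exact one_le_pow₀ (by norm_num)
  have hQ0 : 0 < qQ := by linarith
  -- the Nat identities, cast
  have e1 : (P₀.m1 N (aStar f N) : ℝ) + P₀.m3 N (aStar f N) = P₀.M13 N (aStar f N) := by exact_mod_cast m1_eq f hlp hN
  have e2 : (P₀.M13 N (aStar f N) : ℝ) + ((P₀.kk N * kL N * tStar f N / 2 ^ bLen N : ℕ) : ℝ) + 2 * P₀.slack N + 2 * (2 * N + 2) + 3 =
      kk * ((N + rlen N + kL N : ℕ) : ℝ) + ((P₀.kk N * kL N / 2 ^ (bLen N + 1) : ℕ) : ℝ) := by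
    rw [hkkd]; exact_mod_cast M13_eq f hN
  have e3 : (P₀.m3 N (aStar f N) : ℝ) + P₀.slack N + (2 * N + 2) = ((P₀.kk N * eStar f N * kL N / 2 ^ (bLen N + 2) : ℕ) : ℝ) := by
    exact_mod_cast m3_eq f hlp hN
  -- the floors
  have hB : ((P₀.kk N * kL N / 2 ^ (bLen N + 1) : ℕ) : ℝ) ≤ kk * KK / qQ * (1 / 2) := by
    refine Nat.cast_div_le.trans (le_of_eq ?_); rw [hkkd, hKKd, hqQd]; push_cast; rw [pow_succ]; field_simp
  have hC : kk * KK * tt / qQ - 1 ≤ ((P₀.kk N * kL N * tStar f N / 2 ^ bLen N : ℕ) : ℝ) := by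
    have := div_sub_one_le_cast (P₀.kk N * kL N * tStar f N) (y := 2 ^ bLen N) (by positivity)
    rw [hkkd, hKKd, httd, hqQd]; push_cast at this ⊢; exact this
  have hX : kk * eStar f N * KK / qQ * (1 / 4) - 1 ≤ ((P₀.kk N * eStar f N * kL N / 2 ^ (bLen N + 2) : ℕ) : ℝ) := by
    have := div_sub_one_le_cast (P₀.kk N * eStar f N * kL N) (y := 2 ^ (bLen N + 2)) (by positivity)
    rw [hkkd, hKKd, hqQd]; push_cast at this ⊢
    rw [show (P₀.kk N : ℝ) * eStar f N * kL N / 2 ^ bLen N * (1 / 4) = (P₀.kk N : ℝ) * eStar f N * kL N / 2 ^ (bLen N + 2) by rw [pow_add]; ring]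
    exact this
  have hs1 : kk / qQ * (1 / 16) - 1 ≤ (P₀.slack N : ℝ) := by
    have := div_sub_one_le_cast (P₀.kk N) (y := 16 * 2 ^ bLen N) (by positivity)
    rw [hkkd, hqQd]; push_cast at this ⊢
    rw [show (P₀.kk N : ℝ) / 2 ^ bLen N * (1 / 16) = (P₀.kk N : ℝ) / (16 * 2 ^ bLen N) by ring]; exact this
  -- `ẽ ≥ E − K/(4Q)`, times `k`
  have heK : kk * E - kk * KK / qQ * (1 / 4) ≤ kk * eStar f N * KK / qQ * (1 / 4) := by
    have h := lt_eStar_real hlp hN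
    rw [← hEd, ← hKKd] at h
    have h' : E - KK / qQ * (1 / 4) ≤ eStar f N * KK / qQ * (1 / 4) := by
      rw [sub_lt_iff_lt_add, div_lt_iff₀ hK0, pow_add, ← hqQd] at h
      have key : E * (qQ * 4) ≤ (eStar f N + 1) * KK := by nlinarith
      have h'' : E ≤ ((eStar f N : ℝ) + 1) * KK / (qQ * 4) := by rw [le_div_iff₀ (by positivity)]; linarith [key]
      have e : ((eStar f N : ℝ) + 1) * KK / (qQ * 4) = eStar f N * KK / qQ * (1 / 4) + KK / qQ * (1 / 4) := by ring
      linarith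
    have := mul_le_mul_of_nonneg_left h' hkk0
    linarith [this, show kk * (E - KK / qQ * (1 / 4)) = kk * E - kk * KK / qQ * (1 / 4) by ring,
      show kk * (eStar f N * KK / qQ * (1 / 4)) = kk * eStar f N * KK / qQ * (1 / 4) by ring]
  -- the entropy side: `k H1 ≥ k(c − E − K pND)` and the bound on `pND`
  have hH := mul_le_mul_of_nonneg_left (Params.condEnt_step1 (f := f) N) hkk0
  rw [← hH1d, ← hEd, ← hKKd] at hH
  have hp := Params.pND_le hlp (by omega : 1 ≤ N)
  have hp0 : ((T f 0 N).card : ℝ) / 2 ^ N ≤ tt / qQ := by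
    have h1 := (tStar_sandwich f N).1
    have h2 : (2 : ℝ) ^ N = qQ * 2 ^ nLen N := by rw [hqQd, ← pow_add, Nat.add_comm, nLen_add_bLen (by omega : 1 ≤ N)]
    rw [h2, div_le_div_iff₀ (by positivity) hQ0, httd]
    have : ((T f 0 N).card : ℝ) ≤ tStar f N * 2 ^ nLen N := by exact_mod_cast h1
    nlinarith
  have heL : (2 : ℝ) / 2 ^ eLen N = 1 / qQ ^ 2 * (1 / 8) := by
    rw [eLen, hqQd, show (2 : ℝ) ^ (2 * bLen N + 4) = ((2 : ℝ) ^ bLen N) ^ 2 * 16 by rw [pow_add, pow_mul']; norm_num]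
    field_simp; norm_num
  have hpND : kk * KK * Params.pND f N ≤ kk * KK * tt / qQ - kk * KK / qQ + kk * KK / qQ ^ 2 * (1 / 8) := by
    have h1 : Params.pND f N ≤ tt / qQ - 1 / qQ + 1 / qQ ^ 2 * (1 / 8) := by rw [← heL, hqQd]; linarith
    have := mul_le_mul_of_nonneg_left h1 (mul_nonneg hkk0 hK0.le)
    linarith [this, show kk * KK * (tt / qQ - 1 / qQ + 1 / qQ ^ 2 * (1 / 8)) = kk * KK * tt / qQ - kk * KK / qQ + kk * KK / qQ ^ 2 * (1 / 8) by ring]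
  have hQ8 : kk * KK / qQ ^ 2 * (1 / 8) ≤ kk * KK / qQ * (1 / 4) := by
    have hkK : 0 ≤ kk * KK := mul_nonneg hkk0 hK0.le
    have h1 : kk * KK / qQ ^ 2 ≤ kk * KK / qQ := div_le_div_of_nonneg_left hkK hQ0 (by nlinarith)
    have h2 : 0 ≤ kk * KK / qQ := div_nonneg hkK hQ0.le
    linarith
  have hc : ((N + rlen N + kL N : ℕ) : ℝ) = (N : ℝ) + (rlen N : ℝ) + KK := by simp only [hKKd, Nat.cast_add]
  have hH' : kk * ((N + rlen N + kL N : ℕ) : ℝ) - kk * E - kk * KK * Params.pND f N ≤ kk * H1 := by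
    linarith [hH, show kk * (((N + rlen N + kL N : ℕ) : ℝ) - E - KK * Params.pND f N) =
      kk * ((N + rlen N + kL N : ℕ) : ℝ) - kk * E - kk * KK * Params.pND f N by ring]
  have hsplit : kk * ((N + rlen N + kL N : ℕ) : ℝ) = kk * ((N : ℝ) + (rlen N : ℝ)) + kk * KK := by rw [hc]; ring
  have hb1 : kk / (16 * qQ) = kk / qQ * (1 / 16) := by ring
  rw [hb1]
  linarith [e1, e2, e3, hB, hC, hX, hs1, heK, hH', hpND, hQ8, hkk0, hsplit]

/-- `(K·x)/Q ≤ K·(x/Q) + K`. [folklore] -/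
private theorem mul_div_le_mul_div_add (K x : ℕ) {Q : ℕ} (hQ : 0 < Q) : K * x / Q ≤ K * (x / Q) + K := by
  rcases Nat.eq_zero_or_pos K with rfl | hK
  · simp
  · have hlt : K * x / Q < K * (x / Q) + K := by
      rw [Nat.div_lt_iff_lt_mul hQ]
      have hx : x = Q * (x / Q) + x % Q := (Nat.div_add_mod x Q).symm
      have hm : x % Q < Q := Nat.mod_lt x hQ
      calc K * x = K * (Q * (x / Q)) + K * (x % Q) := by rw [hx]; ring_nf; rw [← hx]
        _ < K * (Q * (x / Q)) + K * Q := by have := Nat.mul_lt_mul_of_pos_left hm hK; omega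
        _ = (K * (x / Q) + K) * Q := by ring
    exact hlt.le

/-- **The stretch**: `Lp + 1 ≤ yLen + m₃ + m₂ + m₁` at the correct advice (`N ≥ 2`), i.e. the core output is longer
than the core seed. [cite: HastadImpagliazzoLevinLuby1999, Thm 7.0.5 (proof: "the output is longer than the input by kₙ/(2n) − 6nkₙ^{2/3} bits")] -/
theorem surplus (hlp : IsLengthPreserving f) {N : ℕ} (hN : 2 ≤ N) :
    P₀.Lp N + 1 ≤ P₀.yLen N + P₀.m3 N (aStar f N) + P₀.m2 N (aStar f N) + P₀.m1 N (aStar f N) := by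
  have h1 := m1_eq f hlp hN
  have hM := M13_eq f hN
  have h2 := m2_eq f hN
  have hK := one_le_K hN
  have hkc := eight_pow_le_kc₀ N
  obtain ⟨hkc16, -, -, hkk⟩ := kc₀_facts N
  have hQpos : 0 < 2 ^ bLen N := Nat.two_pow_pos _
  -- `C ≤ K·D + K`
  have hC : P₀.kk N * kL N * tStar f N / 2 ^ bLen N ≤ kL N * (P₀.kk N * tStar f N / 2 ^ bLen N) + kL N := by
    rw [show P₀.kk N * kL N * tStar f N = kL N * (P₀.kk N * tStar f N) by ring]
    exact mul_div_le_mul_div_add _ _ hQpos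
  -- `4·K·kc² ≤ B` and `8·slack ≤ B`
  have hB4 : 4 * (kL N * P₀.kc N ^ 2) ≤ P₀.kk N * kL N / 2 ^ (bLen N + 1) := by
    rw [Nat.le_div_iff_mul_le (by positivity), hkk, pow_succ]
    calc 4 * (kL N * P₀.kc N ^ 2) * (2 ^ bLen N * 2) = kL N * P₀.kc N ^ 2 * (8 * 2 ^ bLen N) := by ring
      _ ≤ kL N * P₀.kc N ^ 2 * P₀.kc N := Nat.mul_le_mul_left _ hkc
      _ = P₀.kc N ^ 3 * kL N := by ring
  have h8 : 8 * P₀.slack N ≤ P₀.kk N * kL N / 2 ^ (bLen N + 1) := by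
    show 8 * (P₀.kk N / (16 * 2 ^ bLen N)) ≤ P₀.kk N * kL N / 2 ^ (bLen N + 1)
    rw [Nat.le_div_iff_mul_le (by positivity)]
    calc 8 * (P₀.kk N / (16 * 2 ^ bLen N)) * 2 ^ (bLen N + 1) = P₀.kk N / (16 * 2 ^ bLen N) * (16 * 2 ^ bLen N) := by rw [pow_succ]; ring
      _ ≤ P₀.kk N := Nat.div_mul_le_self _ _
      _ ≤ P₀.kk N * kL N := Nat.le_mul_of_pos_right _ hK
  have hKK : kL N ≤ kL N * P₀.kc N ^ 2 := Nat.le_mul_of_pos_right _ (pow_pos (by omega) 2)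
  have hk2 : P₀.kc N ^ 2 ≤ kL N * P₀.kc N ^ 2 := Nat.le_mul_of_pos_left _ hK
  have hkN : 6 * N + 10 ≤ P₀.kc N ^ 2 := by nlinarith
  have hLp : P₀.Lp N = P₀.kk N * (N + rlen N + kL N) + P₀.kk N * (kL N * N) := by
    show P₀.kk N * Params.cP N = _; unfold Params.cP; ring
  have hy : P₀.yLen N = P₀.kk N * (kL N * N) := rfl
  omega

end Arith


/-! ### Lengths of the core output and of the simulator's output -/

namespace Params

variable {P : Params} {f : List Bool → List Bool}

/-- `|Y'(pubs)| = yLen`. [folklore] -/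
theorem length_yOfPubs {N : ℕ} {pubs : List Bool} (hp : pubs.length = P.kk N * pubLen N) : (P.yOfPubs N pubs).length = P.yLen N := by
  rw [yOfPubs, length_flatten_map_range (b := kL N * N) fun i hi => by rw [List.length_drop, length_blkL hp hi, pubLen]; omega, yLen]

/-- **`|coreOut s| = outLen`** for `|s| = coreLen`. [folklore] -/
theorem length_coreOut (N a : ℕ) {s : List Bool} (hs : s.length = P.coreLen N a) :
    (P.coreOut f N a s).length = P.outLen N a := by
  have hcl : P.coreLen N a = P.Lp N + P.uLen N (tOfA N a) + P.key1 N a + P.key3 N a := rfl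
  have hpcs : (s.take (P.Lp N)).length = P.Lp N := by rw [List.length_take]; omega
  simp only [coreOut, lay, List.length_append, length_hashStr, length_yprimes hpcs, List.length_take, List.length_drop, hs, hcl, outLen, m2]
  omega

/-- **`|phiStr β| = outLen`** for `|β| = sLen + rLen`. [folklore] -/
theorem length_phiStr (N a : ℕ) {β : List Bool} (hβ : β.length = P.sLen N (tOfA N a) + P.rLen N a) :
    (P.phiStr N a β).length = P.outLen N a := by
  have hsl : P.sLen N (tOfA N a) = P.mlen N (tOfA N a) + P.kk N * pubLen N + P.uLen N (tOfA N a) := rfl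
  have hrl : P.rLen N a = P.m1 N a + P.key1 N a + P.key3 N a := rfl
  have hpubs : (((β.take (P.sLen N (tOfA N a))).drop (P.mlen N (tOfA N a))).take (P.kk N * pubLen N)).length = P.kk N * pubLen N := by
    rw [List.length_take, List.length_drop, List.length_take]; omega
  have hY := length_yOfPubs hpubs
  simp only [phiStr, lay, List.length_append, length_hashStr]
  rw [hY]
  simp only [List.length_take, List.length_drop, hβ, hsl, hrl, outLen, m2]
  omega

/-- Lengths of the samples of `H₀`. [folklore] -/
theorem length_of_mem_support_X0 (aS : ℕ → ℕ) (N : ℕ) : ∀ s ∈ (P.X0 f aS N).support, s.length = P.outLen N (aS N) := by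
  intro s hs
  rw [X0] at hs
  obtain ⟨r, hr, rfl⟩ := (PMF.mem_support_map_iff _ _ _).1 hs
  exact length_coreOut N (aS N) (length_eq_of_mem_support_uniformBits hr)

end Params

/-! ### The seed length polynomial -/

/-- **The seed length** `d(N)` (a polynomial bounding `coreLen` at every advice in range; the rest of the seed is
passed through). [cite: HastadImpagliazzoLevinLuby1999, Prop. 4.8.1 (the seed length n kₙ)] -/
noncomputable def dP₀ : Polynomial ℕ :=
  kcP₀ ^ 3 * (10 * X ^ 2) + (kcP₀ ^ 3 * X + 1) * mB₀ + 2 * (kcP₀ ^ 3 * (12 * X ^ 2)) * (kcP₀ ^ 3 * (12 * X ^ 2) + 1)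

/-- `coreLen ≤ d(N)` at the correct advice (`N ≥ 2`). [folklore] -/
theorem coreLen_le_dP₀ {f : List Bool → List Bool} (hlp : IsLengthPreserving f) {N : ℕ} (hN : 2 ≤ N) :
    P₀.coreLen N (aStar f N) ≤ dP₀.eval N := by
  have hK := one_le_K hN
  have hKN := kL_le N
  have hcP := cP_le hN
  have h1 := m1_eq f hlp hN
  have hM := M13_eq f hN
  have h3 := m3_eq f hlp hN
  have heK := eStar_mul_K_le hlp hN
  obtain ⟨hkc16, -, -, hkk⟩ := kc₀_facts N
  have ht := tStar_le f N
  -- the pieces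
  have hLp : P₀.Lp N ≤ P₀.kk N * (10 * N ^ 2) := Nat.mul_le_mul_left _ hcP
  have hu : P₀.uLen N (Params.tOfA N (aStar f N)) ≤ (P₀.kk N * N + 1) * mB₀.eval N := by
    rw [tOfA_aStar]
    exact Nat.mul_le_mul (by nlinarith [Nat.mul_le_mul_left (P₀.kk N) hKN]) (mlen₀_le N _ ht)
  have hc2 : N + rlen N + kL N + kL N ≤ 12 * N ^ 2 := by unfold rlen; nlinarith
  have hM13 : P₀.M13 N (aStar f N) ≤ P₀.kk N * (12 * N ^ 2) := by
    have hB : P₀.kk N * kL N / 2 ^ (bLen N + 1) ≤ P₀.kk N * kL N := Nat.div_le_self _ _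
    calc P₀.M13 N (aStar f N) ≤ P₀.M13 N (aStar f N) + (P₀.kk N * kL N * tStar f N / 2 ^ bLen N + 2 * P₀.slack N + 2 * (2 * N + 2) + 3) :=
          Nat.le_add_right _ _
      _ = P₀.kk N * (N + rlen N + kL N) + P₀.kk N * kL N / 2 ^ (bLen N + 1) := by rw [← hM]; ring
      _ ≤ P₀.kk N * (N + rlen N + kL N) + P₀.kk N * kL N := Nat.add_le_add_left hB _
      _ = P₀.kk N * (N + rlen N + kL N + kL N) := by ring
      _ ≤ P₀.kk N * (12 * N ^ 2) := Nat.mul_le_mul_left _ hc2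
  have hm1 : P₀.m1 N (aStar f N) ≤ P₀.kk N * (12 * N ^ 2) := (Nat.le_add_right _ _).trans (h1.le.trans hM13)
  have hm3 : P₀.m3 N (aStar f N) ≤ P₀.kk N * (12 * N ^ 2) := by
    have hX : P₀.kk N * eStar f N * kL N / 2 ^ (bLen N + 2) ≤ P₀.kk N * (N + rlen N) := by
      refine Nat.div_le_of_le_mul ?_
      rw [mul_assoc, pow_add, show (2 : ℕ) ^ 2 = 4 by norm_num]
      calc P₀.kk N * (eStar f N * kL N) ≤ P₀.kk N * (4 * 2 ^ bLen N * (N + rlen N)) := Nat.mul_le_mul_left _ heK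
        _ = 2 ^ bLen N * 4 * (P₀.kk N * (N + rlen N)) := by ring
    calc P₀.m3 N (aStar f N) ≤ P₀.m3 N (aStar f N) + P₀.slack N + (2 * N + 2) := by omega
      _ = _ := h3
      _ ≤ P₀.kk N * (N + rlen N) := hX
      _ ≤ P₀.kk N * (12 * N ^ 2) := Nat.mul_le_mul_left _ (by omega)
  have hLg : Lg N ≤ 12 * N ^ 2 := by have := Lg_le N; unfold rlen at this; nlinarith
  have hfLen : P₀.fLen N ≤ P₀.kk N * (12 * N ^ 2) := Nat.mul_le_mul_left _ hLg
  have hLp' : P₀.Lp N ≤ P₀.kk N * (12 * N ^ 2) := hLp.trans (Nat.mul_le_mul_left _ (by nlinarith))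
  have hk1 : P₀.key1 N (aStar f N) ≤ P₀.kk N * (12 * N ^ 2) * (P₀.kk N * (12 * N ^ 2) + 1) :=
    Nat.mul_le_mul hm1 (Nat.succ_le_succ hLp')
  have hk3 : P₀.key3 N (aStar f N) ≤ P₀.kk N * (12 * N ^ 2) * (P₀.kk N * (12 * N ^ 2) + 1) :=
    Nat.mul_le_mul hm3 (Nat.succ_le_succ hfLen)
  show P₀.Lp N + P₀.uLen N (Params.tOfA N (aStar f N)) + P₀.key1 N (aStar f N) + P₀.key3 N (aStar f N) ≤ _
  have hev : dP₀.eval N = P₀.kk N * (10 * N ^ 2) + (P₀.kk N * N + 1) * mB₀.eval N + 2 * (P₀.kk N * (12 * N ^ 2) * (P₀.kk N * (12 * N ^ 2) + 1)) := by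
    rw [hkk, show P₀.kc N = kcP₀.eval N from rfl]; simp [dP₀]; ring
  rw [hev]; omega

/-! ### Generic tools for the assembly -/

section Tools

/-- A nonnegative sequence eventually below a negligible one is negligible. [folklore] -/
theorem isNegligible_of_eventually_le {μ ν : ℕ → ℝ} (hν : IsNegligible ν) (hν0 : ∀ n, 0 ≤ ν n) (h0 : ∀ n, 0 ≤ μ n)
    (hle : ∀ᶠ n in atTop, μ n ≤ ν n) : IsNegligible μ := by
  rw [isNegligible_iff_eventually_lt_of_nonneg h0]
  intro c
  exact (((isNegligible_iff_eventually_lt_of_nonneg hν0).1 hν c).and hle).mono fun n hn => hn.2.trans_lt hn.1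

/-- **`6/2ⁿ` is negligible.** [folklore] -/
theorem isNegligible_six_div_two_pow : IsNegligible (fun n : ℕ => (6 : ℝ) / 2 ^ n) := by
  rw [isNegligible_iff_eventually_lt_of_nonneg (fun n => by positivity)]
  intro c
  have h := Yao.eventually_natPoly_mul_exp_lt (6 * X ^ c) (Real.log_pos one_lt_two)
  refine (h.and (Filter.eventually_ge_atTop 1)).mono fun n ⟨hn, hn1⟩ => ?_
  have he : Real.exp (-(Real.log 2 * n)) = 1 / 2 ^ n := by
    rw [show -(Real.log 2 * n) = (n : ℝ) * (-Real.log 2) by ring, Real.exp_nat_mul, Real.exp_neg, Real.exp_log two_pos]; simp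
  rw [he] at hn
  simp only [eval_mul, eval_ofNat, eval_pow, eval_X, Nat.cast_mul, Nat.cast_ofNat, Nat.cast_pow] at hn
  have hnpos : (0 : ℝ) < (n : ℝ) ^ c := by positivity
  rw [div_lt_div_iff₀ (by positivity) hnpos]
  have : (6 : ℝ) * (n : ℝ) ^ c * (1 / 2 ^ n) * 2 ^ n = 6 * (n : ℝ) ^ c := by field_simp
  nlinarith [mul_lt_mul_of_pos_right hn (by positivity : (0 : ℝ) < 2 ^ n)]

/-- **Eventually equal ensembles are interchangeable** for computational indistinguishability. [folklore] -/
theorem IsCompIndistinguishable.congr_eventually {X X' Y Y' : Ensemble (List Bool)} (h : IsCompIndistinguishable X Y)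
    (hX : ∀ᶠ n in atTop, X n = X' n) (hY : ∀ᶠ n in atTop, Y n = Y' n) : IsCompIndistinguishable X' Y' := by
  intro D hD
  have heq : ∀ᶠ n in atTop, distAdvantage D X' Y' n = distAdvantage D X Y n := (hX.and hY).mono fun n hn => by
    simp only [distAdvantage, hn.1, hn.2]
  exact isNegligible_of_eventually_le (h D hD) (fun n => distAdvantage_nonneg _ _ _ n) (fun n => distAdvantage_nonneg _ _ _ n)
    (heq.mono fun n hn => hn.le)

/-- An eventual polynomial bound is a polynomial bound. [folklore] -/
theorem exists_poly_bound_of_eventually {b : ℕ → ℕ} {q : Polynomial ℕ} (h : ∀ᶠ n in atTop, b n ≤ q.eval n) :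
    ∃ q' : Polynomial ℕ, ∀ n, b n ≤ q'.eval n := by
  obtain ⟨n₀, hn₀⟩ := Filter.eventually_atTop.1 h
  refine ⟨q + Polynomial.C ((Finset.range n₀).sup b), fun n => ?_⟩
  rw [eval_add, eval_C]
  rcases lt_or_ge n n₀ with hn | hn
  · exact (Finset.le_sup (f := b) (Finset.mem_range.2 hn)).trans (Nat.le_add_left _ _)
  · exact (hn₀ n hn).trans (Nat.le_add_right _ _)

/-- **The truncation program** `⟨1ⁿ, s⟩ ↦ (s ‖ 0…) ↾ (d(n)+1)`. [folklore] -/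
noncomputable def truncF (dP : Polynomial ℕ) : List Bool → List Bool :=
  takeFn ∘ fanoutFn (polyFn (dP + 1) ∘ fstF) (concatFn ∘ fanoutFn sndF (Kannan.zerosFn ∘ polyFn (dP + 1) ∘ fstF))

/-- Value of the truncation program. [folklore] -/
theorem truncF_apply (dP : Polynomial ℕ) (n : ℕ) (s : List Bool) :
    truncF dP (boolPair (unaryEncodeNat n) s) = Params.GenProg.takePad (dP.eval n + 1) s := by
  have hu : (unaryEncodeNat n).length = n := unary_decode_encode_nat n
  simp only [truncF, Function.comp_apply, fanoutFn_apply, fstF_boolPair, sndF_boolPair, polyFn_apply, hu, Kannan.zerosFn_apply, concatFn_boolPair,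
    takeFn_boolPair, eval_add, eval_one, ones, List.length_replicate, Params.GenProg.takePad]

/-- The truncation program is in `FP`. [folklore] -/
theorem truncF_mem_FP (dP : Polynomial ℕ) : truncF dP ∈ FP :=
  comp_mem_FP takeFn_mem_FP (fanoutFn_mem_FP (comp_mem_FP (polyFn_mem_FP _) fstF_mem_FP) (comp_mem_FP concatFn_mem_FP (fanoutFn_mem_FP sndF_mem_FP
    (comp_mem_FP Kannan.zerosFn_mem_FP (comp_mem_FP (polyFn_mem_FP _) fstF_mem_FP)))))

/-- `2^m · (2 · 2^{−kmin}) ≤ 2^{−2N}` when `m + 2N + 1 ≤ kmin`, and then `½ √(…) ≤ 1/2^N`. [folklore] -/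
theorem half_sqrt_le {m N : ℕ} {kmin : ℝ} (h : (m : ℝ) + 2 * N + 1 ≤ kmin) :
    2⁻¹ * Real.sqrt (2 ^ m * (2 * (2 : ℝ) ^ (-kmin))) ≤ 1 / 2 ^ N := by
  have h2 : (0 : ℝ) < 2 := by norm_num
  have hexp : (2 : ℝ) ^ m * (2 * (2 : ℝ) ^ (-kmin)) = (2 : ℝ) ^ ((m : ℝ) + 1 - kmin) := by
    rw [Real.rpow_sub h2, Real.rpow_add h2, Real.rpow_natCast, Real.rpow_one, Real.rpow_neg h2.le, div_eq_mul_inv]; ring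
  have hle : (2 : ℝ) ^ ((m : ℝ) + 1 - kmin) ≤ (2 : ℝ) ^ (-(2 * N : ℝ)) := Real.rpow_le_rpow_of_exponent_le (by norm_num) (by linarith)
  have hpow : (2 : ℝ) ^ (-(N : ℝ)) = 1 / 2 ^ N := by
    rw [Real.rpow_neg h2.le, Real.rpow_natCast, one_div]
  have hsq : (2 : ℝ) ^ (-(2 * N : ℝ)) = (1 / 2 ^ N) ^ 2 := by
    rw [← hpow, ← Real.rpow_natCast ((2 : ℝ) ^ (-(N : ℝ))) 2, ← Real.rpow_mul h2.le]
    congr 1; push_cast; ring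
  have hsqrt : Real.sqrt ((2 : ℝ) ^ (-(2 * N : ℝ))) = 1 / 2 ^ N := by
    rw [hsq, Real.sqrt_sq (by positivity)]
  calc 2⁻¹ * Real.sqrt (2 ^ m * (2 * (2 : ℝ) ^ (-kmin))) ≤ 2⁻¹ * Real.sqrt ((2 : ℝ) ^ (-(2 * N : ℝ))) := by
        rw [hexp]; exact mul_le_mul_of_nonneg_left (Real.sqrt_le_sqrt hle) (by norm_num)
    _ = 2⁻¹ * (1 / 2 ^ N) := by rw [hsqrt]
    _ ≤ 1 / 2 ^ N := by have : (0 : ℝ) ≤ 1 / 2 ^ N := by positivity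
                        linarith

/-- `2e^{−(N+1)} ≤ 2/2^N`. [folklore] -/
theorem two_exp_le (N : ℕ) : 2 * Real.exp (-(N + 1 : ℝ)) ≤ 2 / 2 ^ N := by
  have h1 : Real.exp (-1) ≤ 1 / 2 := by
    rw [Real.exp_neg, inv_eq_one_div, div_le_div_iff₀ (Real.exp_pos 1) (by norm_num), one_mul]
    have := Real.add_one_le_exp (1 : ℝ); linarith
  have h2 : Real.exp (-(N + 1 : ℝ)) ≤ Real.exp (-1) ^ N * Real.exp (-1) := by
    rw [← Real.exp_nat_mul, ← Real.exp_add]; exact Real.exp_le_exp.2 (by nlinarith)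
  have h3 : Real.exp (-1) ^ N ≤ (1 / 2) ^ N := pow_le_pow_left₀ (Real.exp_pos _).le h1 N
  have h4 : Real.exp (-(N + 1 : ℝ)) ≤ (1 / 2) ^ N := by
    calc Real.exp (-(N + 1 : ℝ)) ≤ Real.exp (-1) ^ N * Real.exp (-1) := h2
      _ ≤ (1 / 2) ^ N * 1 := mul_le_mul h3 (by have := Real.add_one_le_exp (-1 : ℝ); linarith [Real.exp_pos (-1 : ℝ), h1]) (Real.exp_pos _).le (by positivity)
      _ = (1 / 2) ^ N := mul_one _
  rw [one_div, inv_pow, ← one_div] at h4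
  rw [show (2 : ℝ) / 2 ^ N = 2 * (1 / 2 ^ N) by ring]
  linarith

end Tools

/-! ### The correct-advice candidate is pseudorandom before padding: `H₀ ≈_c H₃` -/

section Core

variable {f : List Bool → List Bool}

/-- The simulator program for the parameters. [folklore] -/
noncomputable def ΦF₀ (f : List Bool → List Bool) : List Bool → List Bool := Params.GenProg.phiF f kcP₀ MlenProg.mlenF₀

/-- `Params.pubLen N ≤ |β|` for `|β| = sLen(t*) + rLen(a*)`. [folklore] -/
theorem pubLen_le_of_length (f : List Bool → List Bool) (N : ℕ) {β : List Bool} (hβ : β.length = P₀.sLen N (tStar f N) + P₀.rLen N (aStar f N)) :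
    Params.pubLen N ≤ β.length := by
  have hk : 1 ≤ P₀.kk N := Nat.one_le_pow _ _ (one_le_kc₀ N)
  have : Params.pubLen N ≤ P₀.kk N * Params.pubLen N := Nat.le_mul_of_pos_left _ hk
  have hs : P₀.sLen N (tStar f N) = P₀.mlen N (tStar f N) + P₀.kk N * Params.pubLen N + P₀.uLen N (tStar f N) := rfl
  omega

/-- The value of the simulator program on the strings of the hybrids. [folklore] -/
theorem ΦF₀_apply (hlp : IsLengthPreserving f) (N : ℕ) (β : List Bool) (hβ : β.length = P₀.sLen N (tStar f N) + P₀.rLen N (aStar f N)) :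
    ΦF₀ f (boolPair (unaryEncodeNat N) (boolPair (ones (aStar f N)) β)) = P₀.phiStr N (aStar f N) β :=
  Params.GenProg.phiF_apply progSpec₀ hlp N (aStar f N) β (pubLen_le_of_length f N hβ)

/-- The output length of the simulator at the correct advice. [folklore] -/
theorem length_ΦF₀ (hlp : IsLengthPreserving f) (N : ℕ) (β : List Bool) (hβ : β.length = P₀.sLen N (tStar f N) + P₀.rLen N (aStar f N)) :
    (ΦF₀ f (boolPair (unaryEncodeNat N) (boolPair (ones (aStar f N)) β))).length = P₀.outLen N (aStar f N) := by
  rw [ΦF₀_apply hlp N β hβ]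
  exact Params.length_phiStr N (aStar f N) (by rw [tOfA_aStar]; exact hβ)

/-- **The two statistical steps at level `N ≥ 2`** (Cor. 4.5.3 with the exponents above): each at most `3/2^N`.
[cite: HastadImpagliazzoLevinLuby1999, Thm 7.0.5 (proof, steps (1) and (3))] -/
theorem stat_steps_le (hlp : IsLengthPreserving f) (D : RandAlg (List Bool) Bool) {N : ℕ} (hN : 2 ≤ N) :
    distAdvantage D (P₀.X0 f (aStar f)) (P₀.X1 f (ΦF₀ f) (aStar f)) N ≤ 3 / 2 ^ N ∧
      distAdvantage D (P₀.X2 f (ΦF₀ f) (aStar f)) (P₀.X3 (aStar f)) N ≤ 3 / 2 ^ N := by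
  have hk : 0 < P₀.kk N := Nat.one_le_pow _ _ (one_le_kc₀ N)
  have hη : 0 ≤ ηN N := by unfold ηN; positivity
  have hε := hε₀ hN
  have hft := (flat_term_le hN).trans (two_exp_le N)
  have hΦv : ∀ β : List Bool, β.length = P₀.sLen N (tStar f N) + P₀.rLen N (aStar f N) →
      ΦF₀ f (boolPair (unaryEncodeNat N) (boolPair (ones (aStar f N)) β)) = P₀.phiStr N (aStar f N) β := ΦF₀_apply hlp N
  have h3 : (2 : ℝ) / 2 ^ N + 1 / 2 ^ N = 3 / 2 ^ N := by ring
  constructor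
  · have h := Params.abs_prX0_sub_prX1_le (P := P₀) hlp D (tOfA_aStar f N) hΦv hk hη hε
    have hs := half_sqrt_le (exp1_bound (f := f) hlp hN)
    unfold distAdvantage Params.X0 Params.X1
    linarith
  · have h := Params.abs_prX2_sub_prX3_le (P := P₀) hlp D (tOfA_aStar f N) hΦv hk hη hε
    have hs := half_sqrt_le (exp3_bound (f := f) hlp hN)
    unfold distAdvantage Params.X2 Params.X3
    linarith

/-- A global polynomial bound on `sLen(t*)`. [folklore] -/
theorem sLen_le (f : List Bool → List Bool) (N : ℕ) :
    P₀.sLen N (tStar f N) ≤ (mB₀ + kcP₀ ^ 3 * (5 * X + 7 + R0 + X * X) + (kcP₀ ^ 3 * X + 1) * mB₀).eval N := by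
  have hm := mlen₀_le N _ (tStar_le f N)
  have hL := Lg_le N
  have hK := kL_le N
  have hkk : P₀.kk N = kcP₀.eval N ^ 3 := rfl
  have hp : Params.pubLen N ≤ 5 * N + 7 + rlen N + N * N := by unfold Params.pubLen; nlinarith
  have hu : P₀.uLen N (tStar f N) ≤ (P₀.kk N * N + 1) * mB₀.eval N :=
    Nat.mul_le_mul (by nlinarith [Nat.mul_le_mul_left (P₀.kk N) hK]) hm
  show P₀.mlen N (tStar f N) + P₀.kk N * Params.pubLen N + P₀.uLen N (tStar f N) ≤ _
  have hev : (mB₀ + kcP₀ ^ 3 * (5 * X + 7 + R0 + X * X) + (kcP₀ ^ 3 * X + 1) * mB₀).eval N =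
      mB₀.eval N + P₀.kk N * (5 * N + 7 + rlen N + N * N) + (P₀.kk N * N + 1) * mB₀.eval N := by
    rw [hkk]; simp [R0_eval]
  rw [hev]
  exact Nat.add_le_add (Nat.add_le_add hm (Nat.mul_le_mul_left _ hp)) hu

/-- An eventual polynomial bound on `rLen(a*)`. [folklore] -/
theorem rLen_le_eventually (hlp : IsLengthPreserving f) :
    ∀ᶠ N : ℕ in atTop, P₀.rLen N (aStar f N) ≤ (dP₀ + dP₀).eval N := by
  refine Filter.eventually_atTop.2 ⟨2, fun N hN => ?_⟩
  have hc := coreLen_le_dP₀ hlp hN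
  have h1 := m1_eq f hlp hN
  have hM := M13_eq f hN
  -- `m₁ ≤ coreLen ≤ dP₀` is not needed sharply: `m₁ ≤ M13 ≤ k·(c + K) ≤ Lp + Lp ≤ …`; use `m₁ ≤ key1 ≤ coreLen` when `Lp + 1 ≥ 1`
  have hm1 : P₀.m1 N (aStar f N) ≤ P₀.key1 N (aStar f N) := Nat.le_mul_of_pos_right _ (Nat.succ_pos _)
  have hcl : P₀.coreLen N (aStar f N) = P₀.Lp N + P₀.uLen N (Params.tOfA N (aStar f N)) + P₀.key1 N (aStar f N) + P₀.key3 N (aStar f N) := rfl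
  show P₀.m1 N (aStar f N) + P₀.key1 N (aStar f N) + P₀.key3 N (aStar f N) ≤ _
  rw [eval_add]; omega

/-- **`H₀ ≈_c H₃`** for the construction with the correct advice. [cite: HastadImpagliazzoLevinLuby1999, Thm 7.0.5] -/
theorem isCompIndistinguishable_X0_X3 (hf : IsOneWay f) (hlp : IsLengthPreserving f) :
    IsCompIndistinguishable (P₀.X0 f (aStar f)) (P₀.X3 (aStar f)) := by
  obtain ⟨qR, hR⟩ := exists_poly_bound_of_eventually (rLen_le_eventually hlp)
  have hΦ : ΦF₀ f ∈ FP := (Params.GenProg.phiF_mem_FP progSpec₀ hf.1).1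
  have h12 := Params.isCompIndistinguishable_X1_X2 (P := P₀) hlp (isCompIndistinguishable_DE₀ hf hlp) hΦ qA (aStar_le f) qR hR _ (sLen_le f)
    (fun N β hβ => length_ΦF₀ hlp N β hβ)
  intro D hD
  have hadv := h12 D hD
  refine isNegligible_of_eventually_le (isNegligible_six_div_two_pow.add hadv) (fun n => ?_) (fun n => distAdvantage_nonneg _ _ _ n) ?_
  · exact add_nonneg (by positivity) (distAdvantage_nonneg _ _ _ n)
  · refine Filter.eventually_atTop.2 ⟨2, fun N hN => ?_⟩
    obtain ⟨h1, h3⟩ := stat_steps_le hlp D hN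
    -- the triangle inequality for advantages (as `LiuPassLemma53Assembly.distAdvantage_triangle`, not imported here)
    have tri : ∀ X Y Z : Ensemble (List Bool), distAdvantage D X Z N ≤ distAdvantage D X Y N + distAdvantage D Y Z N :=
      fun X Y Z => by unfold distAdvantage; exact abs_sub_le _ _ _
    have ht := tri (P₀.X0 f (aStar f)) (P₀.X1 f (ΦF₀ f) (aStar f)) (P₀.X3 (aStar f))
    have ht' := tri (P₀.X1 f (ΦF₀ f) (aStar f)) (P₀.X2 f (ΦF₀ f) (aStar f)) (P₀.X3 (aStar f))
    show distAdvantage D _ _ N ≤ 6 / 2 ^ N + distAdvantage D _ _ N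
    have h6 : (3 : ℝ) / 2 ^ N + 3 / 2 ^ N = 6 / 2 ^ N := by ring
    linarith

end Core

/-! ### Padding, truncation, and the pseudorandom generator -/

section Final

variable {f : List Bool → List Bool}

/-- The pass-through part of the seed. [folklore] -/
noncomputable def padLen (f : List Bool → List Bool) (N : ℕ) : ℕ := dP₀.eval N - P₀.coreLen N (aStar f N)

/-- The generator program for the parameters. [cite: HastadImpagliazzoLevinLuby1999, Construction 7.0.4] -/
noncomputable def G₀ (f : List Bool → List Bool) : List Bool → List Bool := Params.GenProg.genF f kcP₀ MlenProg.mlenF₀ dP₀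

/-- An eventual polynomial bound on `outLen(a*)`. [folklore] -/
theorem outLen_le_eventually (hlp : IsLengthPreserving f) : ∀ᶠ N : ℕ in atTop, P₀.outLen N (aStar f N) ≤ (dP₀ + dP₀).eval N := by
  refine Filter.eventually_atTop.2 ⟨2, fun N hN => ?_⟩
  have hc := coreLen_le_dP₀ hlp hN
  have h1 := m1_eq f hlp hN
  have hM := M13_eq f hN
  have h3 := m3_eq f hlp hN
  have heK := eStar_mul_K_le hlp hN
  have hKN := kL_le N
  obtain ⟨hkc16, -, -, hkk⟩ := kc₀_facts N
  have hy : P₀.yLen N ≤ P₀.kk N * (10 * N ^ 2) := Nat.mul_le_mul_left _ (by nlinarith)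
  have hm2 : P₀.m2 N (aStar f N) ≤ (P₀.kk N * N + 1) * mB₀.eval N := by
    show P₀.mlen N (Params.tOfA N (aStar f N)) ≤ _
    rw [tOfA_aStar]
    exact (mlen₀_le N _ (tStar_le f N)).trans (Nat.le_mul_of_pos_left _ (Nat.succ_pos _))
  have hc2 : N + rlen N + kL N + kL N ≤ 12 * N ^ 2 := by unfold rlen; nlinarith
  have hM13 : P₀.M13 N (aStar f N) ≤ P₀.kk N * (12 * N ^ 2) := by
    have hB : P₀.kk N * kL N / 2 ^ (bLen N + 1) ≤ P₀.kk N * kL N := Nat.div_le_self _ _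
    calc P₀.M13 N (aStar f N) ≤ P₀.M13 N (aStar f N) + (P₀.kk N * kL N * tStar f N / 2 ^ bLen N + 2 * P₀.slack N + 2 * (2 * N + 2) + 3) :=
          Nat.le_add_right _ _
      _ = P₀.kk N * (N + rlen N + kL N) + P₀.kk N * kL N / 2 ^ (bLen N + 1) := by rw [← hM]; ring
      _ ≤ P₀.kk N * (N + rlen N + kL N) + P₀.kk N * kL N := Nat.add_le_add_left hB _
      _ = P₀.kk N * (N + rlen N + kL N + kL N) := by ring
      _ ≤ P₀.kk N * (12 * N ^ 2) := Nat.mul_le_mul_left _ hc2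
  have hm13 : P₀.m1 N (aStar f N) + P₀.m3 N (aStar f N) ≤ P₀.kk N * (12 * N ^ 2) := h1.le.trans hM13
  have hbig : P₀.kk N * (12 * N ^ 2) ≤ 2 * (P₀.kk N * (12 * N ^ 2) * (P₀.kk N * (12 * N ^ 2) + 1)) := by nlinarith
  have hcl : P₀.coreLen N (aStar f N) = P₀.Lp N + P₀.uLen N (Params.tOfA N (aStar f N)) + P₀.key1 N (aStar f N) + P₀.key3 N (aStar f N) := rfl
  have hev : dP₀.eval N = P₀.kk N * (10 * N ^ 2) + (P₀.kk N * N + 1) * mB₀.eval N + 2 * (P₀.kk N * (12 * N ^ 2) * (P₀.kk N * (12 * N ^ 2) + 1)) := by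
    rw [hkk, show P₀.kc N = kcP₀.eval N from rfl]; simp [dP₀]; ring
  show P₀.key3 N (aStar f N) + P₀.yLen N + P₀.m3 N (aStar f N) + P₀.uLen N (Params.tOfA N (aStar f N)) + P₀.m2 N (aStar f N) + P₀.m1 N (aStar f N) +
    P₀.key1 N (aStar f N) ≤ _
  rw [eval_add]; omega

/-- `H₀ ‖ pad` and `H₃ ‖ pad`. [folklore] -/
noncomputable def GE' (f : List Bool → List Bool) (N : ℕ) : PMF (List Bool) :=
  (P₀.X0 f (aStar f) N).bind fun x => (uniformBits (padLen f N)).map fun r => x ++ r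

/-- `H₃ ‖ pad`. [folklore] -/
noncomputable def UE' (f : List Bool → List Bool) (N : ℕ) : PMF (List Bool) :=
  (P₀.X3 (aStar f) N).bind fun x => (uniformBits (padLen f N)).map fun r => x ++ r

/-- **`(H₀ ‖ pad) ↾ (d+1) ≈_c (H₃ ‖ pad) ↾ (d+1)`** (appending pass-through seed bits of advice-determined length,
then truncating). [cite: HastadImpagliazzoLevinLuby1999, Prop. 4.8.1 (proof: padding the seeds to a common length)] -/
theorem isCompIndistinguishable_trunc (hf : IsOneWay f) (hlp : IsLengthPreserving f) :
    IsCompIndistinguishable (fun N => (GE' f N).map fun s => truncF dP₀ (boolPair (unaryEncodeNat N) s))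
      (fun N => (UE' f N).map fun s => truncF dP₀ (boolPair (unaryEncodeNat N) s)) := by
  obtain ⟨qO, hO⟩ := exists_poly_bound_of_eventually (outLen_le_eventually hlp)
  have hX3 : ∀ N, ∀ s ∈ (P₀.X3 (aStar f) N).support, s.length = P₀.outLen N (aStar f N) := fun N s hs => length_eq_of_mem_support_uniformBits hs
  have h1 := (isCompIndistinguishable_X0_X3 hf hlp).append_uniform_adv (Params.length_of_mem_support_X0 (aStar f)) hX3 ⟨qO, hO⟩ dP₀ (b := padLen f)
    (fun N => Nat.sub_le _ _)
  have hlen : ∀ (Z : Ensemble (List Bool)), (∀ N, ∀ s ∈ (Z N).support, s.length = P₀.outLen N (aStar f N)) →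
      ∀ N, ∀ s ∈ ((Z N).bind fun x => (uniformBits (padLen f N)).map fun r => x ++ r).support, s.length = P₀.outLen N (aStar f N) + padLen f N := by
    intro Z hZ N s hs
    obtain ⟨x, hx, hs'⟩ := (PMF.mem_support_bind_iff _ _ _).1 hs
    obtain ⟨r, hr, rfl⟩ := (PMF.mem_support_map_iff _ _ _).1 hs'
    rw [List.length_append, hZ N x hx, length_eq_of_mem_support_uniformBits hr]
  exact h1.map_fp (hlen _ (Params.length_of_mem_support_X0 (aStar f))) (hlen _ hX3) ⟨qO + dP₀, fun N => by
    rw [eval_add]; exact Nat.add_le_add (hO N) (Nat.sub_le _ _)⟩ (truncF_mem_FP dP₀)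
    (fun N s _ => by rw [truncF_apply, Params.GenProg.length_takePad])

/-- **The real side is the generator on uniform seeds** (`N ≥ 2`). [folklore] -/
theorem GE'_trunc_eq (hlp : IsLengthPreserving f) {N : ℕ} (hN : 2 ≤ N) :
    (GE' f N).map (fun s => truncF dP₀ (boolPair (unaryEncodeNat N) s)) =
      (uniformBits (dP₀.eval N)).map fun s => G₀ f (boolPair (unaryEncodeNat N) (boolPair (ones (aStar f N)) s)) := by
  have hc := coreLen_le_dP₀ hlp hN
  have hd : P₀.coreLen N (aStar f N) + padLen f N = dP₀.eval N := Nat.add_sub_cancel' hc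
  rw [GE', Params.X0, Params.bind_append_uniform_eq_map, hd, PMF.map_comp]
  change (uniformBits _).bind _ = (uniformBits _).bind _
  refine pmf_bind_congr_of_mem_support _ fun s hs => ?_
  have hsl := length_eq_of_mem_support_uniformBits hs
  simp only [Function.comp_apply, truncF_apply]
  rw [show boolPair (unaryEncodeNat N) (boolPair (ones (aStar f N)) s) = Params.GenProg.winp N (aStar f N) s from rfl, G₀,
    Params.GenProg.genF_apply progSpec₀ hlp N (aStar f N) s (one_le_kc₀ N) (by rw [hsl]; exact hc)]

/-- **The ideal side is uniform** (`N ≥ 2`: the core output is longer than the core seed). [folklore] -/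
theorem UE'_trunc_eq (hlp : IsLengthPreserving f) {N : ℕ} (hN : 2 ≤ N) :
    (UE' f N).map (fun s => truncF dP₀ (boolPair (unaryEncodeNat N) s)) = uniformBits (dP₀.eval N + 1) := by
  have hc := coreLen_le_dP₀ hlp hN
  have hsur := surplus f hlp hN
  have hout : P₀.coreLen N (aStar f N) + 1 ≤ P₀.outLen N (aStar f N) := by
    show P₀.Lp N + P₀.uLen N (Params.tOfA N (aStar f N)) + P₀.key1 N (aStar f N) + P₀.key3 N (aStar f N) + 1 ≤
      P₀.key3 N (aStar f N) + P₀.yLen N + P₀.m3 N (aStar f N) + P₀.uLen N (Params.tOfA N (aStar f N)) + P₀.m2 N (aStar f N) + P₀.m1 N (aStar f N) +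
        P₀.key1 N (aStar f N)
    omega
  have hL : dP₀.eval N + 1 ≤ P₀.outLen N (aStar f N) + padLen f N := by unfold padLen; omega
  rw [UE', Params.X3, PRGStretch.uniformBits_add, ← PRGPrefix.uniformBits_map_take hL]
  change (uniformBits _).bind _ = (uniformBits _).bind _
  refine pmf_bind_congr_of_mem_support _ fun s hs => ?_
  have hsl := length_eq_of_mem_support_uniformBits hs
  simp only [Function.comp_apply, truncF_apply]
  rw [Params.GenProg.takePad_eq_take (by rw [hsl]; exact hL)]

/-- **The correct-advice candidate is pseudorandom.** [cite: HastadImpagliazzoLevinLuby1999, Thm 7.0.5] -/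
theorem isPseudorandom_G₀ (hf : IsOneWay f) (hlp : IsLengthPreserving f) :
    IsPseudorandom (fun N => (uniformBits (dP₀.eval N)).map fun s => G₀ f (boolPair (unaryEncodeNat N) (boolPair (ones (aStar f N)) s)))
      (fun N => dP₀.eval N + 1) :=
  IsCompIndistinguishable.congr_eventually (isCompIndistinguishable_trunc hf hlp)
    (Filter.eventually_atTop.2 ⟨2, fun _ hN => GE'_trunc_eq hlp hN⟩) (Filter.eventually_atTop.2 ⟨2, fun _ hN => UE'_trunc_eq hlp hN⟩)

/-- **Pseudorandom generators from any length-preserving one-way function** (HILL 1999: Construction 7.0.4 is a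
mildly non-uniform pseudorandom generator, Thm 7.0.5; mildly non-uniform ⇒ uniform, Prop. 4.8.1 with Prop. 3.3.4).
[cite: HastadImpagliazzoLevinLuby1999, Thm 7.0.5 with Prop. 4.8.1 (the `←` half of Thm 6.2.2)] -/
theorem PRGExist_of_isOneWay_lengthPreserving (hf : IsOneWay f) (hlp : IsLengthPreserving f) : PRGExist :=
  PRGExist_of_advice_levels dP₀ qA (Params.GenProg.genF_mem_FP progSpec₀ hf.1 dP₀) (aStar_le f)
    (fun N s _ => Params.GenProg.length_genF N (aStar f N) s) (isPseudorandom_G₀ hf hlp)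

end Final


end GH

end HILL

end Literature.Computability.Cryptography

/-! ## The named fact `PRGExist_iff_OWFExist` discharged -/

namespace Literature.Computability.Cryptography

/-- **Håstad–Impagliazzo–Levin–Luby 1999, the hard half of Theorem 6.2.2: if one-way functions exist then
pseudorandom generators exist.** Replace the one-way function by a length-preserving one
(`OWFExist.exists_isLengthPreserving`, Goldreich 2001, Prop. 2.2.5) and apply HILL's direct construction
(`HILL.GH.PRGExist_of_isOneWay_lengthPreserving`: Thm 7.0.5 with Prop. 4.8.1).
[cite: HastadImpagliazzoLevinLuby1999, Thm 6.2.2 (proof via §7: Constr. 7.0.4, Thm 7.0.5, Prop. 4.8.1)] -/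
theorem PRGExist_of_OWFExist (h : OWFExist) : PRGExist := by
  obtain ⟨f, hf, hlp⟩ := OWFExist.exists_isLengthPreserving h
  exact HILL.GH.PRGExist_of_isOneWay_lengthPreserving hf hlp

/-- **Håstad–Impagliazzo–Levin–Luby 1999, Theorem 6.2.2: pseudorandom generators exist if and only if one-way
functions exist** — the discharge of the named fact `PRGExist_iff_OWFExist` of `Pseudorandomness.lean`.
`→`: a pseudorandom generator, truncated to stretch `n + 1`, is itself one-way (`OWFExist_of_PRGExist`, [Levin 87] in
HILL's proof; Goldreich 2001, Prop. 3.3.8). `←`: `PRGExist_of_OWFExist` above.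
[cite: HastadImpagliazzoLevinLuby1999, Thm 6.2.2 (proof via §7: Constr. 7.0.4, Thm 7.0.5, Prop. 4.8.1)] -/
theorem PRGExist_iff_OWFExist_holds : PRGExist_iff_OWFExist :=
  ⟨OWFExist_of_PRGExist, PRGExist_of_OWFExist⟩

end Literature.Computability.Cryptography
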